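import Literature.Analysis.FluidPDE.CKNPressureEstimate
import Literature.Analysis.FluidPDE.CKNMorreyQuadraticMean
import Literature.Analysis.FluidPDE.WholeSpaceIBP
import Literature.Analysis.FluidPDE.Seregin2020ScaledEnergyBounds
import HarnessLib

/-!
# The pressure estimate with the velocity entering as `A^{1/2} E`:
# `D(θr) ≤ κ₇ θ⁻² A(r)^{1/2} E(r) + κ₈ θ D(r)` (Seregin 2014, Lemma 6.4, in the plain quantity `D`)

Analysis/FluidPDE proof file (everything proved; no definitions, no named facts), fifth file of
the bottom-up discharge of
`Literature.Analysis.FluidPDE.Seregin2020_axisymmetricSingularPoint_typeII` (G. Seregin,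
Anal. Math. Phys. 10 (2020) = arXiv:2006.04140, Thm. 2.1), serving the case `limsup E < ∞` of
the remark following Def. 1.7 ("`g(z₀) < ∞ ⇒ G(z₀) < ∞`", after Seregin 2006). In that case the
functional of the iteration is `𝓔 = A^{3/2} + ω D²` (Seregin 2014, proof of Thm. 1.4,
(6.1.46)–(6.1.50)), and the pressure must be estimated with the velocity entering SUBLINEARLY in
`A^{3/2}`, as in

> **Lemma 6.4** (Seregin 2014, (6.1.38)). `D₀(r) ≤ c [(r/ϱ)^{5/2} D₀(ϱ) + (ϱ/r)² A^{1/2}(ϱ) E(ϱ)]`,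

whereas the tree's `pressureEstimate` (Robinson–Rodrigo–Sadowski 2016, Lemma 16.7) has
`θ^{-3/2} A^{3/4} E^{3/4}`, which is exactly linear in `A^{3/2}` after squaring and does not
close the iteration. This file proves the plain-`D` form

  `D(θr; z) ≤ κ₇ θ⁻² A(r; z)^{1/2} E(r; z) + κ₈ θ D(r; z)`,  `0 < θ ≤ 1/2`,

(the factor `θ` of the harmonic part instead of `θ^{5/2}`, no mean subtracted in `D`; both are
immaterial for boundedness) by re-running the tree's dual proof of Lemma 16.7
(`CKNPressureDuality`, `CKNPressureDualityFar`, `CKNPressureCZ`, `CKNPressureEstimate`) with ONE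
change, the printed idea of (6.1.40)–(6.1.42): in the Calderón–Zygmund term `∫∫ D²Θ(u, u)` the
slice mean `c = (u)₁(t)` is subtracted in BOTH slots (divergence condition, symmetry of the
Hessian, `∫ ∂ᵢ∂ⱼΘ = 0`), the quadratic terms `(u-c)ᵢ(u-c)ⱼ` are replaced by their mean-free
parts and bounded in `L^{3/2}` by the tree's quadratic Poincaré–Sobolev bound
`exists_lintegral_quadratic_sub_average_le_ball` (`CKNMorreyQuadraticMean.lean`), and
`‖u - c‖_{L²} ≤ (2‖u‖_{L²})^{2/3} (C_P ‖∇u‖_{L²})^{1/3}` (Poincaré–Wirtinger on a third of the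
power) gives the slice bound `c ‖u‖^{2/3} ‖∇u‖^{4/3} ‖θ'(t)‖_{L³}` and, after Hölder in time,
`A^{1/3} E^{2/3} ‖θ'‖_{L³}` — whose `3/2`-th power is `A^{1/2} E`.

## Contents (namespace `Literature.Analysis.FluidPDE.Seregin2020`)

* `enorm_integral_hessian_le_doubleMeanZero_unitScale` — the Calderón–Zygmund term;
* `setLIntegral_pressure_rpow_le_unitScale'` — the dual bound at unit scale;
* `pressureEstimateMeanZero_unitScale`, `pressureEstimateMeanZero` — unit scale and every
  scale (closed cylinders inside the domain, force `f ∈ L¹_loc` divergence free);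
* `pressureEstimateMeanZero_top` — unforced, cylinders `Q_R(z) ⊆ Q` touching the top of the
  domain (inner approximation of `CKNInnerCylinders.lean`, as in `localEnergyBound_top`).

## References

* G. Seregin, *Lecture Notes on Regularity Theory for the Navier–Stokes Equations*, World
  Scientific (2014), Lemma 6.4, (6.1.38)–(6.1.43). [`Seregin2014`]
* J. C. Robinson, J. L. Rodrigo, W. Sadowski, *The three-dimensional Navier–Stokes equations*
  (2016), Lemma 16.7 and its proof, pp. 251–253. [`RobinsonRodrigoSadowski2016`]
* G. Seregin, Anal. Math. Phys. 10 (2020), Paper 46: remark after Def. 1.7. [`Seregin2020`]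
* T.-P. Tsai, Arch. Rational Mech. Anal. 143 (1998), remark after Lemma 4.2. [`Tsai1998`]
-/

noncomputable section

open MeasureTheory Set Function Filter Topology TopologicalSpace Metric InnerProductSpace Module
open scoped ENNReal NNReal RealInnerProductSpace

namespace Literature.Analysis.FluidPDE

namespace Seregin2020

/-! ### Elementary tools -/

/-- `X ≤ P` and `X ≤ R` give `X ≤ P^{2/3} R^{1/3}` in `ℝ≥0∞`. [folklore] -/
theorem le_rpow_two_thirds_mul_rpow_one_third {X P R : ℝ≥0∞} (hP : X ≤ P) (hR : X ≤ R) :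
    X ≤ P ^ (2 / 3 : ℝ) * R ^ (1 / 3 : ℝ) := by
  calc X = X ^ (2 / 3 : ℝ) * X ^ (1 / 3 : ℝ) := by
        rw [← ENNReal.rpow_add_of_nonneg _ _ (by norm_num) (by norm_num)]; norm_num
    _ ≤ P ^ (2 / 3 : ℝ) * R ^ (1 / 3 : ℝ) := by gcongr

/-- Hölder with exponents `3/2, 3`: `∫ f g ≤ (∫ f^{3/2})^{2/3} (∫ g³)^{1/3}`. [folklore] -/
theorem lintegral_mul_le_threeHalves_three' {α : Type*} [MeasurableSpace α] (μ : Measure α)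
    {f g : α → ℝ≥0∞} (hf : AEMeasurable f μ) (hg : AEMeasurable g μ) :
    ∫⁻ x, f x * g x ∂μ ≤ (∫⁻ x, f x ^ (3 / 2 : ℝ) ∂μ) ^ (2 / 3 : ℝ) * (∫⁻ x, g x ^ (3 : ℝ) ∂μ) ^ (1 / 3 : ℝ) := by
  have hpq : (3 / 2 : ℝ).HolderConjugate 3 := Real.holderConjugate_iff.2 ⟨by norm_num, by norm_num⟩
  have key := ENNReal.lintegral_mul_le_Lp_mul_Lq μ hpq hf hg
  rw [show (1 : ℝ) / (3 / 2) = 2 / 3 by norm_num] at key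
  exact key

set_option maxHeartbeats 1600000 in
-- a long measure-theoretic assembly (slicing, Fubini, two Hölder steps); the bump covers this proof only
/-- **The Calderón–Zygmund term with the mean subtracted in both slots** (Seregin 2014,
Lemma 6.4, (6.1.40)–(6.1.42), in the dual form of the tree's
`enorm_integral_hessian_le_meanZero_unitScale`). Let `u` have the weak spatial gradient `G` on
`Q₁ = (-1, 0) × B₁` with `|u|² ∈ L¹_loc(Q₁)`, `A(1), E(1) < ∞`, weakly divergence free; let
`0 < θ`, `0 < ρ`, `θ + ρ ≤ 1`, `θ² ≤ 1`, `θ' ∈ C_c^∞((-θ², 0) × B_θ)`, `Θ(t,·) = N_{ρ/2,ρ}[θ'(t,·)]`.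
Then `‖∫∫_{Q₁} D²Θ(u, u)‖ ≤ 9 C₃ K^{2/3} 2^{2/3} C_P^{1/3} A(1)^{1/3} E(1)^{2/3} ‖θ'‖_{L³}`, where
`C₃` is a Calderón–Zygmund constant at exponent `3`, `K` the constant of the quadratic
Poincaré–Sobolev bound `∫_B |fᵢfⱼ - ⨍ fᵢfⱼ|^{3/2} ≤ K (∫|f|²)^{3/4} (∫|∇f|²)^{3/4}`
(`exists_lintegral_quadratic_sub_average_le_ball`) and `C_P` a Poincaré–Wirtinger constant on
`B₁` in `L²`. For a.e. `t` the mean `c = (u)₁(t)` is subtracted in BOTH slots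
(`∫ D²Θ(u, eₖ) = ∫ D²Θ(eₖ, u) = 0` by the divergence condition and the symmetry of `D²Θ`,
`∫ ∂ᵢ∂ⱼΘ = 0`), the quadratic terms `(u-c)ᵢ(u-c)ⱼ` are replaced by their mean-free parts, and
`‖u - c‖_{L²} ≤ (2‖u‖_{L²})^{2/3} (C_P ‖∇u‖_{L²})^{1/3}` turns the slice bound into
`c ‖u‖^{2/3} ‖∇u‖^{4/3} ‖θ'(t)‖_{L³}`, whose time integral is controlled by `A^{1/3} E^{2/3}`
(this is the gain `A^{1/2}E` versus `A^{3/4}E^{3/4}` of (6.1.42)). [cite: Seregin2014, Lemma 6.4 (6.1.40)–(6.1.42)] -/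
theorem enorm_integral_hessian_le_doubleMeanZero_unitScale {C₃ : ℝ≥0}
    (hC₃ : ∀ ⦃r : ℝ⦄, 0 < r → ∀ ⦃g : EuclideanSpace ℝ (Fin 3) → ℝ⦄, ContDiff ℝ 2 g →
      HasCompactSupport g → ∀ a b : EuclideanSpace ℝ (Fin 3), ‖a‖ ≤ 1 → ‖b‖ ≤ 1 →
        eLpNorm (fun x => fderiv ℝ (fun y => fderiv ℝ (newtonNearPotential (r / 2) r g) y a) x b)
            3 volume ≤ C₃ * eLpNorm g 3 volume)
    {Kq : ℝ≥0}
    (hKq : ∀ (f : EuclideanSpace ℝ (Fin 3) → EuclideanSpace ℝ (Fin 3))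
        (g : EuclideanSpace ℝ (Fin 3) → EuclideanSpace ℝ (Fin 3) →L[ℝ] EuclideanSpace ℝ (Fin 3)),
      FunctionSpaces.HasWeakFDerivOn
        (⟨ball (0 : EuclideanSpace ℝ (Fin 3)) 1, isOpen_ball⟩ : Opens (EuclideanSpace ℝ (Fin 3)))
        volume f g →
      (∫⁻ x in ball (0 : EuclideanSpace ℝ (Fin 3)) 1, ‖f x‖ₑ ^ 2) ≠ ∞ →
      (∫⁻ x in ball (0 : EuclideanSpace ℝ (Fin 3)) 1, ENNReal.ofReal (frobeniusNormSq (g x))) ≠ ∞ →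
      ∀ i j : Fin 3,
      ∫⁻ x in ball (0 : EuclideanSpace ℝ (Fin 3)) 1, ‖⟪f x, EuclideanSpace.basisFun (Fin 3) ℝ i⟫ *
          ⟪f x, EuclideanSpace.basisFun (Fin 3) ℝ j⟫ -
          ⨍ y in ball (0 : EuclideanSpace ℝ (Fin 3)) 1, ⟪f y, EuclideanSpace.basisFun (Fin 3) ℝ i⟫ *
            ⟪f y, EuclideanSpace.basisFun (Fin 3) ℝ j⟫‖ₑ ^ (3 / 2 : ℝ) ≤
        Kq * (∫⁻ x in ball (0 : EuclideanSpace ℝ (Fin 3)) 1, ‖f x‖ₑ ^ 2) ^ (3 / 4 : ℝ) *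
          (∫⁻ x in ball (0 : EuclideanSpace ℝ (Fin 3)) 1, ENNReal.ofReal (frobeniusNormSq (g x))) ^ (3 / 4 : ℝ))
    {CP : ℝ≥0}
    (hCP : ∀ (v : EuclideanSpace ℝ (Fin 3) → EuclideanSpace ℝ (Fin 3))
      (Dv : EuclideanSpace ℝ (Fin 3) → EuclideanSpace ℝ (Fin 3) →L[ℝ] EuclideanSpace ℝ (Fin 3)),
      FunctionSpaces.MemSobolevDomain 1 2
        (⟨ball (0 : EuclideanSpace ℝ (Fin 3)) 1, isOpen_ball⟩ : Opens (EuclideanSpace ℝ (Fin 3)))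
        volume v →
      FunctionSpaces.HasWeakFDerivOn
        (⟨ball (0 : EuclideanSpace ℝ (Fin 3)) 1, isOpen_ball⟩ : Opens (EuclideanSpace ℝ (Fin 3)))
        volume v Dv →
      eLpNorm (fun x => v x - ⨍ y in ball (0 : EuclideanSpace ℝ (Fin 3)) 1, v y) 2
          (volume.restrict (ball (0 : EuclideanSpace ℝ (Fin 3)) 1)) ≤
        CP * eLpNorm Dv 2 (volume.restrict (ball (0 : EuclideanSpace ℝ (Fin 3)) 1)))
    {u : ℝ → EuclideanSpace ℝ (Fin 3) → EuclideanSpace ℝ (Fin 3)}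
    {G : ℝ → EuclideanSpace ℝ (Fin 3) → EuclideanSpace ℝ (Fin 3) →L[ℝ] EuclideanSpace ℝ (Fin 3)}
    (hG : HasWeakSpatialGradientOn (parabolicCylinderOpens 1 (0 : ℝ × EuclideanSpace ℝ (Fin 3))) u G)
    (hu2 : LocallyIntegrableOn (fun z : ℝ × EuclideanSpace ℝ (Fin 3) => ‖u z.1 z.2‖ ^ 2)
      (parabolicCylinder 1 (0 : ℝ × EuclideanSpace ℝ (Fin 3))) volume)
    (hdiv : ∀ ϑ : ℝ → EuclideanSpace ℝ (Fin 3) → ℝ,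
      IsSpaceTimeTestOn (parabolicCylinderOpens 1 (0 : ℝ × EuclideanSpace ℝ (Fin 3))) ϑ →
      ∫ z in parabolicCylinder 1 (0 : ℝ × EuclideanSpace ℝ (Fin 3)),
        ⟪u z.1 z.2, gradient (ϑ z.1) z.2⟫ = 0)
    (hA : cknAEss 1 0 u ≠ ∞) (hE : cknE 1 0 G ≠ ∞)
    {θ ρ : ℝ} (hρ : 0 < ρ) (hθρ : θ + ρ ≤ 1) (hθ1 : θ ^ 2 ≤ 1)
    {θ' : ℝ → EuclideanSpace ℝ (Fin 3) → ℝ}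
    (hθ' : IsSpaceTimeTestOn (⟨Ioo (-θ ^ 2) 0 ×ˢ ball (0 : EuclideanSpace ℝ (Fin 3)) θ,
      isOpen_Ioo.prod isOpen_ball⟩ : Opens (ℝ × EuclideanSpace ℝ (Fin 3))) θ') :
    ‖∫ z in parabolicCylinder 1 (0 : ℝ × EuclideanSpace ℝ (Fin 3)),
        fderiv ℝ (fderiv ℝ (newtonNearPotential (ρ / 2) ρ (θ' z.1))) z.2 (u z.1 z.2) (u z.1 z.2)‖ₑ ≤
      9 * C₃ * (Kq : ℝ≥0∞) ^ (2 / 3 : ℝ) * 2 ^ (2 / 3 : ℝ) * (CP : ℝ≥0∞) ^ (1 / 3 : ℝ) *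
        cknAEss 1 0 u ^ (1 / 3 : ℝ) * cknE 1 0 G ^ (2 / 3 : ℝ) *
        (∫⁻ z in Ioo (-θ ^ 2) 0 ×ˢ ball (0 : EuclideanSpace ℝ (Fin 3)) θ,
          ‖θ' z.1 z.2‖ₑ ^ (3 : ℝ)) ^ (1 / 3 : ℝ) := by
  have h₀ : 0 < ρ / 2 := by positivity
  have h₁ : ρ / 2 < ρ := by linarith
  -- ### sets
  set e := EuclideanSpace.basisFun (Fin 3) ℝ with he
  have he1 : ∀ k, ‖e k‖ = 1 := fun k => e.orthonormal.1 k
  set I : Set ℝ := Ioo (-1) 0 with hI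
  set B : Set (EuclideanSpace ℝ (Fin 3)) := ball 0 1 with hB
  set Iθ : Set ℝ := Ioo (-θ ^ 2) 0 with hIθ
  set S : Set (ℝ × EuclideanSpace ℝ (Fin 3)) := Ioo (-θ ^ 2) 0 ×ˢ ball (0 : EuclideanSpace ℝ (Fin 3)) θ
    with hS
  set S' : Set (ℝ × EuclideanSpace ℝ (Fin 3)) :=
    Ioo (-θ ^ 2) 0 ×ˢ ball (0 : EuclideanSpace ℝ (Fin 3)) (θ + ρ) with hS'
  have hcyl : parabolicCylinder 1 (0 : ℝ × EuclideanSpace ℝ (Fin 3)) = I ×ˢ B := by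
    simp [parabolicCylinder, hI, hB]
  have hIθI : Iθ ⊆ I := Ioo_subset_Ioo (by linarith) le_rfl
  have hS'Q : S' ⊆ I ×ˢ B := prod_mono hIθI (ball_subset_ball hθρ)
  have hV0 : volume B ≠ 0 := (measure_ball_pos volume _ one_pos).ne'
  have hVtop : volume B ≠ ∞ := measure_ball_lt_top.ne
  -- ### the potential `Θ` and its Hessian
  set Θ : ℝ → EuclideanSpace ℝ (Fin 3) → ℝ := fun t => newtonNearPotential (ρ / 2) ρ (θ' t)
    with hΘdef
  have hΘ := hθ'.newtonNearPotential_slice h₀.le h₁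
  have hΘ2 : ∀ t, ContDiff ℝ 2 (Θ t) := fun t => contDiff_infty.1 (hΘ.contDiff_slice t) 2
  set K : Set (ℝ × EuclideanSpace ℝ (Fin 3)) := tsupport (uncurry Θ) with hK
  have hKc : IsCompact K := hΘ.hasCompactSupport
  have hKS' : K ⊆ S' := hΘ.tsupport_subset
  have hKQ : K ⊆ I ×ˢ B := hKS'.trans hS'Q
  set L : ℝ → EuclideanSpace ℝ (Fin 3) →
      (EuclideanSpace ℝ (Fin 3) →L[ℝ] EuclideanSpace ℝ (Fin 3) →L[ℝ] ℝ) :=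
    fun t x => fderiv ℝ (fderiv ℝ (Θ t)) x with hL
  have hL0 : ∀ z : ℝ × EuclideanSpace ℝ (Fin 3), z ∉ K → L z.1 z.2 = 0 := by
    intro z hz
    ext d c
    rw [hL, ← fderiv_apply_const_apply_eq (hΘ2 z.1) z.2 c d]
    exact fderiv_fderiv_slice_eq_zero_of_notMem_tsupport (ψ := Θ) hz _ _
  -- symmetry of the Hessian
  have hsymm : ∀ t x (v w : EuclideanSpace ℝ (Fin 3)), L t x v w = L t x w v := fun t x v w =>
    ((hΘ2 t).contDiffAt.isSymmSndFDerivAt (by simp)) v w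
  -- the entries and a uniform bound
  set H : Fin 3 → Fin 3 → ℝ × EuclideanSpace ℝ (Fin 3) → ℝ := fun i j z => L z.1 z.2 (e i) (e j)
    with hH
  have hHc : ∀ i j, Continuous (H i j) := fun i j => by
    have := hΘ.continuous_fderiv_fderiv_slice (e j) (e i)
    refine this.congr fun z => ?_
    simp only [hH, hL]
    exact fderiv_apply_const_apply_eq (hΘ2 z.1) z.2 (e j) (e i)
  have hH0 : ∀ i j z, z ∉ K → H i j z = 0 := fun i j z hz => by
    simp [hH, hL0 z hz]
  have hHbdd : ∀ i j, ∃ M, ∀ z, ‖H i j z‖ ≤ M := fun i j =>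
    (hHc i j).bounded_above_of_compact_support (HasCompactSupport.intro hKc (hH0 i j))
  choose Mij hMij using hHbdd
  set M : ℝ := ∑ i, ∑ j, Mij i j with hM
  have hLM : ∀ (z : ℝ × EuclideanSpace ℝ (Fin 3)) (v w : EuclideanSpace ℝ (Fin 3)),
      ‖L z.1 z.2 v w‖ ≤ M * ‖v‖ * ‖w‖ := by
    intro z v w
    refine (norm_clm_apply_apply_le_sum_mul (L z.1 z.2) v w).trans ?_
    gcongr
    rw [hM]
    exact Finset.sum_le_sum fun i _ => Finset.sum_le_sum fun j _ => hMij i j z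
  have hM0 : 0 ≤ M := by
    have := hLM (0, 0) (e 0) (e 0)
    rw [he1 0, mul_one, mul_one] at this
    exact (norm_nonneg _).trans this
  -- the entries integrate to zero on each slice (`∫ ∂ᵢ∂ⱼΘ(t,·) = 0`)
  have hHint0 : ∀ t i j, ∫ x, H i j (t, x) = 0 := fun t i j => by
    have h1 : ContDiff ℝ 1 (fun y => fderiv ℝ (Θ t) y (e j)) :=
      ((hΘ2 t).fderiv_right (m := 1) le_rfl).clm_apply contDiff_const
    have h2 : HasCompactSupport (fun y => fderiv ℝ (Θ t) y (e j)) :=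
      (hΘ.hasCompactSupport_slice t).fderiv_apply (𝕜 := ℝ) (e j)
    have h3 := integral_fderiv_apply_eq_zero h1 h2 (e i)
    have heq : ∀ x, fderiv ℝ (fun y => fderiv ℝ (Θ t) y (e j)) x (e i) = H i j (t, x) := fun x => by
      simp only [hH, hL]
      exact fderiv_apply_const_apply_eq (hΘ2 t) x (e j) (e i)
    simp_rw [heq] at h3
    exact h3
  -- the entries are integrable on each slice, with `L³` norm controlled by `θ'(t)`
  set T : ℝ → ℝ≥0∞ := fun t => ∫⁻ x, ‖θ' t x‖ₑ ^ (3 : ℝ) with hT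
  have hHslice_int : ∀ t i j, Integrable (fun x => H i j (t, x)) volume := fun t i j => by
    refine ((hHc i j).comp (Continuous.prodMk_right t)).integrable_of_hasCompactSupport ?_
    refine HasCompactSupport.intro (isCompact_closedBall (0 : EuclideanSpace ℝ (Fin 3)) 1)
      fun x hx => hH0 i j (t, x) fun h => hx (ball_subset_closedBall (hKQ h).2)
  have hHL3 : ∀ t i j, (∫⁻ x, ‖H i j (t, x)‖ₑ ^ (3 : ℝ)) ^ (1 / 3 : ℝ) ≤ C₃ * T t ^ (1 / 3 : ℝ) := by
    intro t i j
    have h := hC₃ hρ (contDiff_infty.1 (hθ'.contDiff_slice t) 2) (hθ'.hasCompactSupport_slice t)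
      (e j) (e i) (he1 j).le (he1 i).le
    have heq : ∀ x, fderiv ℝ (fun y => fderiv ℝ (newtonNearPotential (ρ / 2) ρ (θ' t)) y (e j)) x (e i) =
        H i j (t, x) := fun x => by
      simp only [hH, hL, hΘdef]
      exact fderiv_apply_const_apply_eq (hΘ2 t) x (e j) (e i)
    simp_rw [heq] at h
    rw [eLpNorm_eq_lintegral_rpow_enorm_toReal (by norm_num) (by norm_num),
      eLpNorm_eq_lintegral_rpow_enorm_toReal (by norm_num) (by norm_num), ENNReal.toReal_ofNat] at h
    exact h
  -- ### the integrand `F = D²Θ(u,u)` and its integrability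
  set F : ℝ × EuclideanSpace ℝ (Fin 3) → ℝ := fun z => L z.1 z.2 (u z.1 z.2) (u z.1 z.2) with hF
  have hF0 : ∀ z, z ∉ K → F z = 0 := fun z hz => by
    simp [hF, hL0 z hz]
  have hum : AEStronglyMeasurable (uncurry u) (volume.restrict (I ×ˢ B)) := by
    have := hG.locallyIntegrableOn.aestronglyMeasurable
    rwa [coe_parabolicCylinderOpens, hcyl] at this
  have hu2K : IntegrableOn (fun z : ℝ × EuclideanSpace ℝ (Fin 3) => ‖u z.1 z.2‖ ^ 2) K volume :=
    hu2.integrableOn_compact_subset (hcyl ▸ hKQ) hKc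
  have hFexp : ∀ z, F z = ∑ i, ∑ j, ⟪u z.1 z.2, e i⟫ * ⟪u z.1 z.2, e j⟫ * H i j z := fun z =>
    clm_apply_apply_eq_sum_basisFun (L z.1 z.2) _ _
  have hFint : Integrable F (volume : Measure (ℝ × EuclideanSpace ℝ (Fin 3))) := by
    have heq : F = fun z => ∑ i, ∑ j, ⟪u z.1 z.2, e i⟫ * ⟪u z.1 z.2, e j⟫ * H i j z := funext hFexp
    rw [heq]
    refine integrable_finsetSum _ fun i _ => integrable_finsetSum _ fun j _ => ?_
    -- dominated by `Mᵢⱼ 𝟙_K |u|²`, supported in `K ⊆ I × B`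
    have hIB : IntegrableOn (fun z : ℝ × EuclideanSpace ℝ (Fin 3) =>
        ⟪u z.1 z.2, e i⟫ * ⟪u z.1 z.2, e j⟫ * H i j z) (I ×ˢ B) volume := by
      have hmeas : AEStronglyMeasurable (fun z : ℝ × EuclideanSpace ℝ (Fin 3) =>
          ⟪u z.1 z.2, e i⟫ * ⟪u z.1 z.2, e j⟫ * H i j z) (volume.restrict (I ×ˢ B)) :=
        ((hum.inner aestronglyMeasurable_const).mul (hum.inner aestronglyMeasurable_const)).mul
          (hHc i j).aestronglyMeasurable
      refine Integrable.mono' (g := fun z => Mij i j * K.indicator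
        (fun z : ℝ × EuclideanSpace ℝ (Fin 3) => ‖u z.1 z.2‖ ^ 2) z) ?_ hmeas (ae_of_all _ fun z => ?_)
      · exact (((integrable_indicator_iff hKc.isClosed.measurableSet).2 hu2K).const_mul
          (Mij i j)).mono_measure Measure.restrict_le_self
      · by_cases hz : z ∈ K
        · rw [indicator_of_mem hz, norm_mul, norm_mul]
          have h1 : ‖⟪u z.1 z.2, e i⟫‖ ≤ ‖u z.1 z.2‖ :=
            (norm_inner_le_norm _ _).trans (by rw [e.orthonormal.1 i, mul_one])
          have h2 : ‖⟪u z.1 z.2, e j⟫‖ ≤ ‖u z.1 z.2‖ :=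
            (norm_inner_le_norm _ _).trans (by rw [e.orthonormal.1 j, mul_one])
          calc ‖⟪u z.1 z.2, e i⟫‖ * ‖⟪u z.1 z.2, e j⟫‖ * ‖H i j z‖
              ≤ ‖u z.1 z.2‖ * ‖u z.1 z.2‖ * Mij i j :=
                mul_le_mul (mul_le_mul h1 h2 (norm_nonneg _) (norm_nonneg _)) (hMij i j z)
                  (norm_nonneg _) (mul_nonneg (norm_nonneg _) (norm_nonneg _))
            _ = Mij i j * ‖u z.1 z.2‖ ^ 2 := by ring
        · rw [hH0 i j z hz, mul_zero, norm_zero, indicator_of_notMem hz, mul_zero]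
    exact hIB.integrable_of_forall_notMem_eq_zero fun z hz => by
      rw [hH0 i j z (fun h => hz (hKQ h)), mul_zero]
  -- ### Fubini: `∫∫_{Q₁} F = ∫ (∫ F(t, x) dx) dt`
  have hFint' : Integrable F ((volume : Measure ℝ).prod (volume : Measure (EuclideanSpace ℝ (Fin 3)))) := by
    rwa [← Measure.volume_eq_prod]
  have hFubini : ∫ z in parabolicCylinder 1 (0 : ℝ × EuclideanSpace ℝ (Fin 3)), F z =
      ∫ t, ∫ x, F (t, x) := by
    rw [setIntegral_eq_integral_of_forall_compl_eq_zero (fun z hz => hF0 z fun h =>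
      hz (hcyl ▸ hKQ h)), Measure.volume_eq_prod, integral_prod F hFint']
  -- ### slice facts, a.e. in `t`
  set a : ℝ → ℝ≥0∞ := fun t => ∫⁻ x in B, ‖u t x‖ₑ ^ 2 with ha
  set en : ℝ → ℝ≥0∞ := fun t => ∫⁻ x in B, ENNReal.ofReal (frobeniusNormSq (G t x)) with hen
  set A := cknAEss 1 0 u with hAdef
  set EE := cknE 1 0 G with hEdef
  have hQI : Ioo ((0 : ℝ × EuclideanSpace ℝ (Fin 3)).1 - 1 ^ 2) (0 : ℝ × EuclideanSpace ℝ (Fin 3)).1 = I := by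
    simp [hI]
  have hprod : (volume.restrict (I ×ˢ B) : Measure (ℝ × EuclideanSpace ℝ (Fin 3))) =
      (volume.restrict I).prod (volume.restrict B) := by
    rw [Measure.volume_eq_prod, Measure.prod_restrict]
  have hGm : AEStronglyMeasurable (uncurry G) (volume.restrict (I ×ˢ B)) := by
    have := hG.locallyIntegrableOn_grad.aestronglyMeasurable
    rwa [coe_parabolicCylinderOpens, hcyl] at this
  have hGm2 : AEMeasurable (fun q : ℝ × EuclideanSpace ℝ (Fin 3) =>
      ENNReal.ofReal (frobeniusNormSq (G q.1 q.2))) ((volume.restrict I).prod (volume.restrict B)) := by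
    rw [← hprod]
    exact (continuous_frobeniusNormSq'.comp_aestronglyMeasurable hGm).aemeasurable.ennreal_ofReal
  have hEeq : EE = ∫⁻ t in I, en t := by
    rw [hEdef, cknE, ENNReal.ofReal_one, inv_one, one_mul, hcyl, Measure.volume_eq_prod,
      setLIntegral_prod _ (by rwa [← Measure.prod_restrict])]
  have henm : AEMeasurable en (volume.restrict I) := hGm2.lintegral_prod_right'
  have h2 : ∀ᵐ t ∂(volume.restrict I), en t < ∞ := by
    refine ae_lt_top' henm ?_
    rw [← hEeq]; exact hE
  have h3 : ∀ᵐ t ∂(volume.restrict I), FunctionSpaces.HasWeakFDerivOn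
      (⟨B, isOpen_ball⟩ : Opens (EuclideanSpace ℝ (Fin 3))) volume (u t) (G t) := by
    have := hG.ae_hasWeakFDerivOn_ball
    rwa [hQI] at this
  have h23 := (ae_restrict_iff' measurableSet_Ioo).1 (h2.and h3)
  obtain ⟨hslice, -, -⟩ := ae_slice_sq_facts hG hA
  -- divergence-free slices against the Hessian
  have hzero : ∀ᵐ t ∂(volume : Measure ℝ), ∀ k : Fin 3, ∫ x, L t x (u t x) (e k) = 0 := by
    have hΘQ : IsSpaceTimeTestOn (parabolicCylinderOpens 1 (0 : ℝ × EuclideanSpace ℝ (Fin 3))) Θ :=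
      ⟨hΘ.contDiff, hΘ.hasCompactSupport, by
        rw [coe_parabolicCylinderOpens, hcyl]; exact hKQ⟩
    exact ae_integral_hessian_apply_basisFun_eq_zero (Q := parabolicCylinderOpens 1 0)
      hG.locallyIntegrableOn hdiv hΘQ
  -- slices of `F` are integrable
  have hFslice : ∀ᵐ t ∂(volume : Measure ℝ), Integrable (fun x => F (t, x)) volume :=
    hFint'.prod_right_ae
  -- ### the slice-wise bound
  set cS : ℝ≥0∞ := 9 * C₃ * (Kq : ℝ≥0∞) ^ (2 / 3 : ℝ) * 2 ^ (2 / 3 : ℝ) * (CP : ℝ≥0∞) ^ (1 / 3 : ℝ)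
    with hcS
  have hmain : ∀ᵐ t ∂(volume : Measure ℝ),
      ‖∫ x, F (t, x)‖ₑ ≤ Iθ.indicator (fun t => cS * A ^ (1 / 3 : ℝ) *
        (en t ^ (2 / 3 : ℝ) * T t ^ (1 / 3 : ℝ))) t := by
    filter_upwards [h23, hslice, hzero, hFslice] with t h23t hsl hz hFs
    by_cases htI : t ∈ Iθ
    swap
    · -- off `(-θ², 0)` the slice of `F` vanishes
      have hFt : ∀ x, F (t, x) = 0 := fun x => hF0 (t, x) fun h => htI (hKS' h).1
      simp only [hFt, integral_zero, enorm_zero, zero_le]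
    rw [indicator_of_mem htI]
    have htI' : t ∈ I := hIθI htI
    obtain ⟨het, hwt⟩ := h23t htI'
    obtain ⟨hutm, hint2, hat, -⟩ := hsl htI'
    -- the slice `u(t)` on `B`
    haveI : IsFiniteMeasure (volume.restrict B) :=
      isFiniteMeasure_restrict.2 measure_ball_lt_top.ne
    have hu2t : MemLp (u t) 2 (volume.restrict B) :=
      (memLp_two_iff_integrable_sq_norm hutm).2 hint2
    have hu1t : Integrable (u t) (volume.restrict B) := hu2t.integrable one_le_two
    set c : EuclideanSpace ℝ (Fin 3) := ⨍ y in B, u t y with hc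
    set w : EuclideanSpace ℝ (Fin 3) → EuclideanSpace ℝ (Fin 3) := fun x => u t x - c with hwdef
    -- integrability of `x ↦ D²Θ(t)(x)(u(t,x), v)` for fixed `v`
    have hLt0 : ∀ x, x ∉ B → L t x = 0 := fun x hx => hL0 (t, x) fun h => hx (hKQ h).2
    have hmeasw : ∀ v : EuclideanSpace ℝ (Fin 3), AEStronglyMeasurable (fun x => L t x (u t x) v)
        (volume.restrict B) := by
      intro v
      have heq : (fun x => L t x (u t x) v) = fun x => ∑ i, ∑ j, ⟪u t x, e i⟫ * ⟪v, e j⟫ * H i j (t, x) := by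
        funext x; exact clm_apply_apply_eq_sum_basisFun (L t x) _ _
      rw [heq]
      refine Finset.aestronglyMeasurable_fun_sum _ fun i _ =>
        Finset.aestronglyMeasurable_fun_sum _ fun j _ => ?_
      exact ((hutm.inner aestronglyMeasurable_const).mul aestronglyMeasurable_const).mul
        ((hHc i j).comp (Continuous.prodMk_right t)).aestronglyMeasurable
    have hLw : ∀ v : EuclideanSpace ℝ (Fin 3), Integrable (fun x => L t x (u t x) v) volume := by
      intro v
      have hIB : IntegrableOn (fun x => L t x (u t x) v) B volume := by
        refine Integrable.mono' (hu1t.norm.const_mul (M * ‖v‖)) (hmeasw v) (ae_of_all _ fun x => ?_)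
        calc ‖L t x (u t x) v‖ ≤ M * ‖u t x‖ * ‖v‖ := hLM (t, x) _ _
          _ = M * ‖v‖ * ‖u t x‖ := by ring
      exact hIB.integrable_of_forall_notMem_eq_zero fun x hx => by
        simp [hLt0 x hx]
    -- ### Step A: subtract the mean in both slots
    have hFuc0 : ∫ x, L t x (u t x) c = 0 := by
      have hexp : ∀ x, L t x (u t x) c = ∑ k, ⟪c, e k⟫ * L t x (u t x) (e k) := by
        intro x
        have hcsum : c = ∑ k, ⟪c, e k⟫ • e k := by
          conv_lhs => rw [← e.sum_repr' c]
          exact Finset.sum_congr rfl fun k _ => by rw [real_inner_comm]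
        conv_lhs => rw [hcsum]
        rw [map_sum]
        exact Finset.sum_congr rfl fun k _ => by rw [map_smul, smul_eq_mul]
      simp_rw [hexp]
      rw [integral_finsetSum _ fun k _ => (hLw (e k)).const_mul _]
      refine Finset.sum_eq_zero fun k _ => ?_
      rw [integral_const_mul, hz k, mul_zero]
    have hFcu0 : ∫ x, L t x c (u t x) = 0 := by
      simp_rw [hsymm t _ c]
      exact hFuc0
    have hcc : ∀ x, L t x c c = ∑ i, ∑ j, ⟪c, e i⟫ * ⟪c, e j⟫ * H i j (t, x) := fun x =>
      clm_apply_apply_eq_sum_basisFun (L t x) c c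
    have hFcc_int : Integrable (fun x => L t x c c) volume := by
      have heq : (fun x => L t x c c) = fun x => ∑ i, ∑ j, ⟪c, e i⟫ * ⟪c, e j⟫ * H i j (t, x) :=
        funext hcc
      rw [heq]
      exact integrable_finsetSum _ fun i _ => integrable_finsetSum _ fun j _ =>
        (hHslice_int t i j).const_mul _
    have hFcc0 : ∫ x, L t x c c = 0 := by
      simp_rw [hcc]
      rw [integral_finsetSum _ fun i _ => integrable_finsetSum _ fun j _ =>
        (hHslice_int t i j).const_mul _]
      refine Finset.sum_eq_zero fun i _ => ?_
      rw [integral_finsetSum _ fun j _ => (hHslice_int t i j).const_mul _]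
      refine Finset.sum_eq_zero fun j _ => ?_
      rw [integral_const_mul, hHint0 t i j, mul_zero]
    have hcu_int : Integrable (fun x => L t x c (u t x)) volume := by
      have : (fun x => L t x c (u t x)) = fun x => L t x (u t x) c := funext fun x => hsymm t x c _
      rw [this]; exact hLw c
    have hsplit : ∀ x, L t x (w x) (w x) =
        F (t, x) - L t x (u t x) c - L t x c (u t x) + L t x c c := fun x => by
      simp only [hwdef, hF, map_sub, FunLike.coe_sub, Pi.sub_apply]
      ring
    have hww_int : Integrable (fun x => L t x (w x) (w x)) volume := by
      have : (fun x => L t x (w x) (w x)) =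
          fun x => F (t, x) - L t x (u t x) c - L t x c (u t x) + L t x c c := funext hsplit
      rw [this]
      exact ((hFs.sub (hLw c)).sub hcu_int).add hFcc_int
    have hStepA : ∫ x, F (t, x) = ∫ x, L t x (w x) (w x) := by
      have i1 : Integrable (fun x => F (t, x) - L t x (u t x) c) volume := hFs.sub (hLw c)
      have i2 : Integrable (fun x => F (t, x) - L t x (u t x) c - L t x c (u t x)) volume :=
        i1.sub hcu_int
      simp_rw [hsplit]
      rw [integral_add i2 hFcc_int, integral_sub i1 hcu_int, integral_sub hFs (hLw c), hFuc0, hFcu0,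
        hFcc0]
      ring
    -- ### Step B: expansion in components and subtraction of the means of the quadratic terms
    set q : Fin 3 → Fin 3 → EuclideanSpace ℝ (Fin 3) → ℝ := fun i j x => ⟪w x, e i⟫ * ⟪w x, e j⟫ with hq
    set m : Fin 3 → Fin 3 → ℝ := fun i j => ⨍ y in B, ⟪w y, e i⟫ * ⟪w y, e j⟫ with hm
    have hwm : AEStronglyMeasurable w (volume.restrict B) := hutm.sub aestronglyMeasurable_const
    have hw2 : MemLp w 2 (volume.restrict B) := hu2t.sub (memLp_const c)
    have hwint2 : IntegrableOn (fun x => ‖w x‖ ^ 2) B volume :=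
      (memLp_two_iff_integrable_sq_norm hwm).1 hw2
    have hqH_int : ∀ i j, Integrable (fun x => q i j x * H i j (t, x)) volume := by
      intro i j
      have hmeas : AEStronglyMeasurable (fun x => q i j x * H i j (t, x)) (volume.restrict B) :=
        ((hwm.inner aestronglyMeasurable_const).mul (hwm.inner aestronglyMeasurable_const)).mul
          ((hHc i j).comp (Continuous.prodMk_right t)).aestronglyMeasurable
      have hIB : IntegrableOn (fun x => q i j x * H i j (t, x)) B volume := by
        refine Integrable.mono' (hwint2.const_mul (Mij i j)) hmeas (ae_of_all _ fun x => ?_)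
        rw [norm_mul, hq]
        simp only [norm_mul]
        have h1 : ‖⟪w x, e i⟫‖ ≤ ‖w x‖ := (norm_inner_le_norm _ _).trans (by rw [he1 i, mul_one])
        have h2 : ‖⟪w x, e j⟫‖ ≤ ‖w x‖ := (norm_inner_le_norm _ _).trans (by rw [he1 j, mul_one])
        calc ‖⟪w x, e i⟫‖ * ‖⟪w x, e j⟫‖ * ‖H i j (t, x)‖ ≤ ‖w x‖ * ‖w x‖ * Mij i j :=
              mul_le_mul (mul_le_mul h1 h2 (norm_nonneg _) (norm_nonneg _)) (hMij i j (t, x))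
                (norm_nonneg _) (mul_nonneg (norm_nonneg _) (norm_nonneg _))
          _ = Mij i j * ‖w x‖ ^ 2 := by ring
      exact hIB.integrable_of_forall_notMem_eq_zero fun x hx => by
        rw [hH0 i j (t, x) (fun h => hx (hKQ h).2), mul_zero]
    have hStepB : ∫ x, L t x (w x) (w x) = ∑ i, ∑ j, ∫ x, (q i j x - m i j) * H i j (t, x) := by
      have hexp : ∀ x, L t x (w x) (w x) = ∑ i, ∑ j, q i j x * H i j (t, x) := fun x =>
        clm_apply_apply_eq_sum_basisFun (L t x) _ _
      simp_rw [hexp]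
      rw [integral_finsetSum _ fun i _ => integrable_finsetSum _ fun j _ => hqH_int i j]
      refine Finset.sum_congr rfl fun i _ => ?_
      rw [integral_finsetSum _ fun j _ => hqH_int i j]
      refine Finset.sum_congr rfl fun j _ => ?_
      have : ∀ x, (q i j x - m i j) * H i j (t, x) = q i j x * H i j (t, x) - m i j * H i j (t, x) :=
        fun x => by ring
      simp_rw [this]
      rw [integral_sub (hqH_int i j) ((hHslice_int t i j).const_mul _), integral_const_mul,
        hHint0 t i j, mul_zero, sub_zero]
    -- ### Step C: Hölder on each entry and the quadratic Poincaré–Sobolev bound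
    set aw : ℝ≥0∞ := ∫⁻ x in B, ‖w x‖ₑ ^ 2 with haw
    have hwt' : FunctionSpaces.HasWeakFDerivOn (⟨B, isOpen_ball⟩ : Opens (EuclideanSpace ℝ (Fin 3)))
        volume w (G t) := hwt.sub_const' c
    have hL2w : eLpNorm w 2 (volume.restrict B) = aw ^ (1 / 2 : ℝ) := by
      rw [eLpNorm_eq_lintegral_rpow_enorm_toReal two_ne_zero ENNReal.ofNat_ne_top, ENNReal.toReal_ofNat, haw]
      simp only [one_div]
      congr 1
      refine lintegral_congr fun x => ?_
      rw [show (2 : ℝ) = ((2 : ℕ) : ℝ) by norm_num, ENNReal.rpow_natCast]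
    have hawtop : aw ≠ ∞ := by
      have := hw2.eLpNorm_lt_top
      rw [hL2w] at this
      intro h
      rw [h, ENNReal.top_rpow_of_pos (by norm_num)] at this
      exact lt_irrefl _ this
    have hentry : ∀ i j, ‖∫ x, (q i j x - m i j) * H i j (t, x)‖ₑ ≤
        (Kq : ℝ≥0∞) ^ (2 / 3 : ℝ) * aw ^ (1 / 2 : ℝ) * en t ^ (1 / 2 : ℝ) * (C₃ * T t ^ (1 / 3 : ℝ)) := by
      intro i j
      have hsupp : support (fun x => ‖(q i j x - m i j) * H i j (t, x)‖ₑ) ⊆ B := by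
        intro x hx
        by_contra hxB
        exact hx (by simp [hH0 i j (t, x) (fun h => hxB (hKQ h).2)])
      have hqm : AEMeasurable (fun x => ‖q i j x - m i j‖ₑ) (volume.restrict B) :=
        (((hwm.inner aestronglyMeasurable_const).mul (hwm.inner aestronglyMeasurable_const)).sub
          aestronglyMeasurable_const).enorm
      have hHm : AEMeasurable (fun x => ‖H i j (t, x)‖ₑ) (volume.restrict B) :=
        ((hHc i j).comp (Continuous.prodMk_right t)).aestronglyMeasurable.enorm
      have hKqij := hKq w (G t) hwt' hawtop het.ne i j
      calc ‖∫ x, (q i j x - m i j) * H i j (t, x)‖ₑ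
          ≤ ∫⁻ x, ‖(q i j x - m i j) * H i j (t, x)‖ₑ := enorm_integral_le_lintegral_enorm _
        _ = ∫⁻ x in B, ‖(q i j x - m i j) * H i j (t, x)‖ₑ := (setLIntegral_eq_of_support_subset hsupp).symm
        _ = ∫⁻ x in B, ‖q i j x - m i j‖ₑ * ‖H i j (t, x)‖ₑ := by
            refine lintegral_congr fun x => ?_; rw [enorm_mul]
        _ ≤ (∫⁻ x in B, ‖q i j x - m i j‖ₑ ^ (3 / 2 : ℝ)) ^ (2 / 3 : ℝ) *
            (∫⁻ x in B, ‖H i j (t, x)‖ₑ ^ (3 : ℝ)) ^ (1 / 3 : ℝ) :=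
            lintegral_mul_le_threeHalves_three' _ hqm hHm
        _ ≤ ((Kq : ℝ≥0∞) * aw ^ (3 / 4 : ℝ) * en t ^ (3 / 4 : ℝ)) ^ (2 / 3 : ℝ) *
            (∫⁻ x, ‖H i j (t, x)‖ₑ ^ (3 : ℝ)) ^ (1 / 3 : ℝ) := by
            exact mul_le_mul' (ENNReal.rpow_le_rpow hKqij (by norm_num))
              (ENNReal.rpow_le_rpow (lintegral_mono' Measure.restrict_le_self le_rfl) (by norm_num))
        _ ≤ ((Kq : ℝ≥0∞) * aw ^ (3 / 4 : ℝ) * en t ^ (3 / 4 : ℝ)) ^ (2 / 3 : ℝ) * (C₃ * T t ^ (1 / 3 : ℝ)) := by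
            gcongr; exact hHL3 t i j
        _ = _ := by
            rw [ENNReal.mul_rpow_of_nonneg _ _ (by norm_num : (0 : ℝ) ≤ 2 / 3),
              ENNReal.mul_rpow_of_nonneg (Kq : ℝ≥0∞) (aw ^ (3 / 4 : ℝ)) (by norm_num : (0 : ℝ) ≤ 2 / 3),
              ← ENNReal.rpow_mul aw, ← ENNReal.rpow_mul (en t)]
            norm_num
    -- ### Step D: the two bounds for `‖u - c‖_{L²(B₁)}`
    have hawP : aw ^ (1 / 2 : ℝ) ≤ CP * en t ^ (1 / 2 : ℝ) := by
      have hsob : FunctionSpaces.MemSobolevDomain 1 2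
          (⟨B, isOpen_ball⟩ : Opens (EuclideanSpace ℝ (Fin 3))) volume (u t) := by
        have hGtm : AEStronglyMeasurable (G t) (volume.restrict B) :=
          hwt.locallyIntegrableOn_deriv.aestronglyMeasurable
        have hg2 : MemLp (G t) 2 (volume.restrict B) :=
          ⟨hGtm, (eLpNorm_two_le_lintegral_frobeniusNormSq_rpow _ _).trans_lt
            (ENNReal.rpow_lt_top_of_nonneg (by norm_num) het.ne)⟩
        refine FunctionSpaces.memSobolevDomain_succ_iff.2 ⟨hu2t, G t, hwt, fun v => ?_⟩
        rw [FunctionSpaces.memSobolevDomain_zero_iff]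
        exact (ContinuousLinearMap.apply ℝ (EuclideanSpace ℝ (Fin 3)) v).comp_memLp' hg2
      have h1 := hCP (u t) (G t) hsob hwt
      rw [← hL2w]
      exact h1.trans (by gcongr; exact eLpNorm_two_le_lintegral_frobeniusNormSq_rpow _ _)
    have hawA : aw ^ (1 / 2 : ℝ) ≤ 2 * a t ^ (1 / 2 : ℝ) := by
      have hL2u : eLpNorm (u t) 2 (volume.restrict B) = a t ^ (1 / 2 : ℝ) := by
        rw [eLpNorm_eq_lintegral_rpow_enorm_toReal two_ne_zero ENNReal.ofNat_ne_top, ENNReal.toReal_ofNat, ha]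
        simp only [one_div]
        congr 1
        refine lintegral_congr fun x => ?_
        rw [show (2 : ℝ) = ((2 : ℕ) : ℝ) by norm_num, ENNReal.rpow_natCast]
      -- the constant `c`: `‖c‖ₑ |B|^{1/2} ≤ ‖u(t)‖_{L²(B)}`
      have hcB : ‖c‖ₑ * volume B ^ (1 / 2 : ℝ) ≤ a t ^ (1 / 2 : ℝ) := by
        have h1 : ‖c‖ₑ ≤ (volume B)⁻¹ * ∫⁻ x in B, ‖u t x‖ₑ := by
          rw [hc, setAverage_eq, enorm_smul]
          gcongr
          · rw [measureReal_def, Real.enorm_eq_ofReal (inv_nonneg.2 ENNReal.toReal_nonneg),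
              ENNReal.ofReal_inv_of_pos (ENNReal.toReal_pos hV0 hVtop), ENNReal.ofReal_toReal hVtop]
          · exact enorm_integral_le_lintegral_enorm _
        have h2 : ∫⁻ x in B, ‖u t x‖ₑ ≤ a t ^ (1 / 2 : ℝ) * volume B ^ (1 / 2 : ℝ) := by
          have h22 : (2 : ℝ).HolderConjugate 2 := Real.holderConjugate_iff.2 ⟨by norm_num, by norm_num⟩
          have k := ENNReal.lintegral_mul_le_Lp_mul_Lq (volume.restrict B) h22 hutm.enorm
            (g := fun _ => 1) aemeasurable_const
          simp only [Pi.mul_apply, mul_one, ENNReal.one_rpow, lintegral_const, one_mul,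
            Measure.restrict_apply_univ] at k
          have e2 : (∫⁻ x in B, ‖u t x‖ₑ ^ (2 : ℝ)) = a t := by
            rw [ha]; refine lintegral_congr fun x => ?_
            rw [show (2 : ℝ) = ((2 : ℕ) : ℝ) by norm_num, ENNReal.rpow_natCast]
          rw [e2] at k
          exact k
        calc ‖c‖ₑ * volume B ^ (1 / 2 : ℝ) ≤ ((volume B)⁻¹ * (a t ^ (1 / 2 : ℝ) * volume B ^ (1 / 2 : ℝ))) *
              volume B ^ (1 / 2 : ℝ) := by gcongr; exact h1.trans (by gcongr)
          _ = a t ^ (1 / 2 : ℝ) * ((volume B)⁻¹ * (volume B ^ (1 / 2 : ℝ) * volume B ^ (1 / 2 : ℝ))) := by ring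
          _ = a t ^ (1 / 2 : ℝ) := by
              rw [← ENNReal.rpow_add_of_nonneg _ _ (by norm_num) (by norm_num),
                show (1 / 2 : ℝ) + 1 / 2 = 1 by norm_num, ENNReal.rpow_one,
                ENNReal.inv_mul_cancel hV0 hVtop, mul_one]
      have hν0 : (volume.restrict B : Measure (EuclideanSpace ℝ (Fin 3))) ≠ 0 := by
        rw [Ne, Measure.restrict_eq_zero]; exact hV0
      have hconst : eLpNorm (fun _ : EuclideanSpace ℝ (Fin 3) => c) 2 (volume.restrict B) =
          ‖c‖ₑ * volume B ^ (1 / 2 : ℝ) := by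
        rw [eLpNorm_const c two_ne_zero hν0, Measure.restrict_apply_univ, ENNReal.toReal_ofNat]
      have hweq : w = (u t) - fun _ => c := rfl
      rw [← hL2w, hweq]
      calc eLpNorm ((u t) - fun _ => c) 2 (volume.restrict B)
          ≤ eLpNorm (u t) 2 (volume.restrict B) + eLpNorm (fun _ : EuclideanSpace ℝ (Fin 3) => c) 2
              (volume.restrict B) := eLpNorm_sub_le hutm aestronglyMeasurable_const one_le_two
        _ ≤ a t ^ (1 / 2 : ℝ) + a t ^ (1 / 2 : ℝ) := by rw [hL2u, hconst]; exact add_le_add le_rfl hcB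
        _ = 2 * a t ^ (1 / 2 : ℝ) := (two_mul _).symm
    have hawD : aw ^ (1 / 2 : ℝ) ≤ 2 ^ (2 / 3 : ℝ) * (CP : ℝ≥0∞) ^ (1 / 3 : ℝ) *
        (a t ^ (1 / 3 : ℝ) * en t ^ (1 / 6 : ℝ)) := by
      refine (le_rpow_two_thirds_mul_rpow_one_third hawA hawP).trans (le_of_eq ?_)
      rw [ENNReal.mul_rpow_of_nonneg _ _ (by norm_num : (0 : ℝ) ≤ 2 / 3),
        ENNReal.mul_rpow_of_nonneg _ _ (by norm_num : (0 : ℝ) ≤ 1 / 3), ← ENNReal.rpow_mul (a t),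
        ← ENNReal.rpow_mul (en t)]
      norm_num
      ring
    -- ### Step E: the slice bound
    have hsum : ‖∫ x, F (t, x)‖ₑ ≤ 9 * ((Kq : ℝ≥0∞) ^ (2 / 3 : ℝ) * aw ^ (1 / 2 : ℝ) * en t ^ (1 / 2 : ℝ) *
        (C₃ * T t ^ (1 / 3 : ℝ))) := by
      rw [hStepA, hStepB]
      refine (enorm_sum_le _ _).trans ?_
      calc ∑ i, ‖∑ j, ∫ x, (q i j x - m i j) * H i j (t, x)‖ₑ
          ≤ ∑ i : Fin 3, ∑ j : Fin 3, ((Kq : ℝ≥0∞) ^ (2 / 3 : ℝ) * aw ^ (1 / 2 : ℝ) * en t ^ (1 / 2 : ℝ) *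
              (C₃ * T t ^ (1 / 3 : ℝ))) :=
            Finset.sum_le_sum fun i _ => (enorm_sum_le _ _).trans (Finset.sum_le_sum fun j _ => hentry i j)
        _ = _ := by
            simp only [Finset.sum_const, Finset.card_univ, Fintype.card_fin, nsmul_eq_mul]
            push_cast
            ring
    calc ‖∫ x, F (t, x)‖ₑ
        ≤ 9 * ((Kq : ℝ≥0∞) ^ (2 / 3 : ℝ) * aw ^ (1 / 2 : ℝ) * en t ^ (1 / 2 : ℝ) * (C₃ * T t ^ (1 / 3 : ℝ))) := hsum
      _ ≤ 9 * ((Kq : ℝ≥0∞) ^ (2 / 3 : ℝ) * (2 ^ (2 / 3 : ℝ) * (CP : ℝ≥0∞) ^ (1 / 3 : ℝ) *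
          (a t ^ (1 / 3 : ℝ) * en t ^ (1 / 6 : ℝ))) * en t ^ (1 / 2 : ℝ) * (C₃ * T t ^ (1 / 3 : ℝ))) := by
          gcongr
      _ ≤ 9 * ((Kq : ℝ≥0∞) ^ (2 / 3 : ℝ) * (2 ^ (2 / 3 : ℝ) * (CP : ℝ≥0∞) ^ (1 / 3 : ℝ) *
          (A ^ (1 / 3 : ℝ) * en t ^ (1 / 6 : ℝ))) * en t ^ (1 / 2 : ℝ) * (C₃ * T t ^ (1 / 3 : ℝ))) := by
          gcongr
      _ = cS * A ^ (1 / 3 : ℝ) * ((en t ^ (1 / 6 : ℝ) * en t ^ (1 / 2 : ℝ)) * T t ^ (1 / 3 : ℝ)) := by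
          rw [hcS]; ring
      _ = cS * A ^ (1 / 3 : ℝ) * (en t ^ (2 / 3 : ℝ) * T t ^ (1 / 3 : ℝ)) := by
          rw [← ENNReal.rpow_add_of_nonneg _ _ (by norm_num) (by norm_num)]; norm_num
  -- ### integrate the slice bound in time
  have hTm : Measurable T := by
    have : Measurable fun z : ℝ × EuclideanSpace ℝ (Fin 3) => ‖θ' z.1 z.2‖ₑ ^ (3 : ℝ) :=
      (hθ'.contDiff.continuous.measurable.enorm.pow_const _)
    exact this.lintegral_prod_right'
  have henmθ : AEMeasurable en (volume.restrict Iθ) :=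
    henm.mono_measure (Measure.restrict_mono hIθI le_rfl)
  have hT0 : ∀ t, t ∉ Iθ → T t = 0 := by
    intro t ht
    have h0 : (fun x => ‖θ' t x‖ₑ ^ (3 : ℝ)) = fun _ => 0 := funext fun x => by
      rw [hθ'.apply_eq_zero (fun h => ht h.1), enorm_zero, ENNReal.zero_rpow_of_pos (by norm_num)]
    show ∫⁻ x, ‖θ' t x‖ₑ ^ (3 : ℝ) = 0
    rw [h0, lintegral_zero]
  have hTtot : ∫⁻ t in Iθ, T t = ∫⁻ z in S, ‖θ' z.1 z.2‖ₑ ^ (3 : ℝ) := by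
    have hmeas : AEMeasurable (fun z : ℝ × EuclideanSpace ℝ (Fin 3) => ‖θ' z.1 z.2‖ₑ ^ (3 : ℝ))
        ((volume : Measure ℝ).prod (volume : Measure (EuclideanSpace ℝ (Fin 3)))) := by
      rw [← Measure.volume_eq_prod]
      exact (hθ'.contDiff.continuous.measurable.enorm.pow_const _).aemeasurable
    have hsupp : support (fun z : ℝ × EuclideanSpace ℝ (Fin 3) => ‖θ' z.1 z.2‖ₑ ^ (3 : ℝ)) ⊆ S := by
      intro z hz
      by_contra hzS
      have h0 : θ' z.1 z.2 = 0 := hθ'.apply_eq_zero hzS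
      exact hz (by simp [h0, ENNReal.zero_rpow_of_pos (by norm_num : (0 : ℝ) < 3)])
    have hsuppT : support T ⊆ Iθ := fun t ht => by_contra fun h => ht (hT0 t h)
    calc ∫⁻ t in Iθ, T t = ∫⁻ t, T t := setLIntegral_eq_of_support_subset hsuppT
      _ = ∫⁻ z : ℝ × EuclideanSpace ℝ (Fin 3), ‖θ' z.1 z.2‖ₑ ^ (3 : ℝ) := by
          rw [Measure.volume_eq_prod, lintegral_prod _ hmeas]
      _ = ∫⁻ z in S, ‖θ' z.1 z.2‖ₑ ^ (3 : ℝ) := (setLIntegral_eq_of_support_subset hsupp).symm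
  have hcStop : cS * A ^ (1 / 3 : ℝ) ≠ ∞ := by
    refine ENNReal.mul_ne_top ?_ (ENNReal.rpow_ne_top_of_nonneg (by norm_num) hA)
    rw [hcS]
    refine ENNReal.mul_ne_top (ENNReal.mul_ne_top (ENNReal.mul_ne_top (by simp [ENNReal.mul_ne_top])
      (ENNReal.rpow_ne_top_of_nonneg (by norm_num) ENNReal.coe_ne_top))
      (ENNReal.rpow_ne_top_of_nonneg (by norm_num) ENNReal.ofNat_ne_top))
      (ENNReal.rpow_ne_top_of_nonneg (by norm_num) ENNReal.coe_ne_top)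
  calc ‖∫ z in parabolicCylinder 1 (0 : ℝ × EuclideanSpace ℝ (Fin 3)), F z‖ₑ
      = ‖∫ t, ∫ x, F (t, x)‖ₑ := by rw [hFubini]
    _ ≤ ∫⁻ t, ‖∫ x, F (t, x)‖ₑ := enorm_integral_le_lintegral_enorm _
    _ ≤ ∫⁻ t, Iθ.indicator (fun t => cS * A ^ (1 / 3 : ℝ) *
        (en t ^ (2 / 3 : ℝ) * T t ^ (1 / 3 : ℝ))) t := lintegral_mono_ae hmain
    _ = cS * A ^ (1 / 3 : ℝ) * ∫⁻ t in Iθ, en t ^ (2 / 3 : ℝ) * T t ^ (1 / 3 : ℝ) := by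
        rw [lintegral_indicator measurableSet_Ioo, lintegral_const_mul' _ _ hcStop]
    _ ≤ cS * A ^ (1 / 3 : ℝ) * ((∫⁻ t in Iθ, en t) ^ (2 / 3 : ℝ) * (∫⁻ t in Iθ, T t) ^ (1 / 3 : ℝ)) := by
        gcongr
        have k1 := lintegral_mul_le_threeHalves_three' (volume.restrict Iθ)
          (henmθ.pow_const (2 / 3 : ℝ)) (hTm.aemeasurable.pow_const (1 / 3 : ℝ))
        have e1 : ∀ x, (en x ^ (2 / 3 : ℝ)) ^ (3 / 2 : ℝ) = en x := fun x => by
          rw [← ENNReal.rpow_mul]; norm_num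
        have e2 : ∀ x, (T x ^ (1 / 3 : ℝ)) ^ (3 : ℝ) = T x := fun x => by
          rw [← ENNReal.rpow_mul]; norm_num
        simp only [e1, e2] at k1
        exact k1
    _ ≤ cS * A ^ (1 / 3 : ℝ) * (EE ^ (2 / 3 : ℝ) * (∫⁻ z in S, ‖θ' z.1 z.2‖ₑ ^ (3 : ℝ)) ^ (1 / 3 : ℝ)) := by
        gcongr
        · rw [hEeq]; exact lintegral_mono_set hIθI
        · rw [hTtot]
    _ = _ := by rw [hcS]; ring

/-! ### Lemma 6.4 at unit scale, dual form -/

set_option maxHeartbeats 800000 in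
-- the test-function bound assembles several long statements; the bump covers this proof only
/-- **Seregin 2014, Lemma 6.4 at unit scale, dual form** (the analogue of the tree's
`setLIntegral_pressure_rpow_le_unitScale` with the Calderón–Zygmund term of
`enorm_integral_hessian_le_doubleMeanZero_unitScale`): for a suitable weak solution (`ν = 1`) on
`Q` with locally integrable divergence-free force, `G` a weak spatial gradient,
`closure Q₁ ⊆ Q`, `0 < θ ≤ 1/2`,
`∫∫_{Q_θ} |p|^{3/2} ≤ (c_S A(1)^{1/3} E(1)^{2/3} + L |B₁| θ² D(1)^{2/3})^{3/2}`,
`c_S = 9 C₃ K^{2/3} 2^{2/3} C_P^{1/3}`. [cite: Seregin2014, Lemma 6.4 (6.1.38)–(6.1.43)] -/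
theorem setLIntegral_pressure_rpow_le_unitScale' {C₃ : ℝ≥0}
    (hC₃ : ∀ ⦃r : ℝ⦄, 0 < r → ∀ ⦃g : EuclideanSpace ℝ (Fin 3) → ℝ⦄, ContDiff ℝ 2 g →
      HasCompactSupport g → ∀ a b : EuclideanSpace ℝ (Fin 3), ‖a‖ ≤ 1 → ‖b‖ ≤ 1 →
        eLpNorm (fun x => fderiv ℝ (fun y => fderiv ℝ (newtonNearPotential (r / 2) r g) y a) x b)
            3 volume ≤ C₃ * eLpNorm g 3 volume)
    {Kq : ℝ≥0}
    (hKq : ∀ (f : EuclideanSpace ℝ (Fin 3) → EuclideanSpace ℝ (Fin 3))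
        (g : EuclideanSpace ℝ (Fin 3) → EuclideanSpace ℝ (Fin 3) →L[ℝ] EuclideanSpace ℝ (Fin 3)),
      FunctionSpaces.HasWeakFDerivOn
        (⟨ball (0 : EuclideanSpace ℝ (Fin 3)) 1, isOpen_ball⟩ : Opens (EuclideanSpace ℝ (Fin 3)))
        volume f g →
      (∫⁻ x in ball (0 : EuclideanSpace ℝ (Fin 3)) 1, ‖f x‖ₑ ^ 2) ≠ ∞ →
      (∫⁻ x in ball (0 : EuclideanSpace ℝ (Fin 3)) 1, ENNReal.ofReal (frobeniusNormSq (g x))) ≠ ∞ →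
      ∀ i j : Fin 3,
      ∫⁻ x in ball (0 : EuclideanSpace ℝ (Fin 3)) 1, ‖⟪f x, EuclideanSpace.basisFun (Fin 3) ℝ i⟫ *
          ⟪f x, EuclideanSpace.basisFun (Fin 3) ℝ j⟫ -
          ⨍ y in ball (0 : EuclideanSpace ℝ (Fin 3)) 1, ⟪f y, EuclideanSpace.basisFun (Fin 3) ℝ i⟫ *
            ⟪f y, EuclideanSpace.basisFun (Fin 3) ℝ j⟫‖ₑ ^ (3 / 2 : ℝ) ≤
        Kq * (∫⁻ x in ball (0 : EuclideanSpace ℝ (Fin 3)) 1, ‖f x‖ₑ ^ 2) ^ (3 / 4 : ℝ) *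
          (∫⁻ x in ball (0 : EuclideanSpace ℝ (Fin 3)) 1, ENNReal.ofReal (frobeniusNormSq (g x))) ^ (3 / 4 : ℝ))
    {CP : ℝ≥0}
    (hCP : ∀ (v : EuclideanSpace ℝ (Fin 3) → EuclideanSpace ℝ (Fin 3))
      (Dv : EuclideanSpace ℝ (Fin 3) → EuclideanSpace ℝ (Fin 3) →L[ℝ] EuclideanSpace ℝ (Fin 3)),
      FunctionSpaces.MemSobolevDomain 1 2
        (⟨ball (0 : EuclideanSpace ℝ (Fin 3)) 1, isOpen_ball⟩ : Opens (EuclideanSpace ℝ (Fin 3)))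
        volume v →
      FunctionSpaces.HasWeakFDerivOn
        (⟨ball (0 : EuclideanSpace ℝ (Fin 3)) 1, isOpen_ball⟩ : Opens (EuclideanSpace ℝ (Fin 3)))
        volume v Dv →
      eLpNorm (fun x => v x - ⨍ y in ball (0 : EuclideanSpace ℝ (Fin 3)) 1, v y) 2
          (volume.restrict (ball (0 : EuclideanSpace ℝ (Fin 3)) 1)) ≤
        CP * eLpNorm Dv 2 (volume.restrict (ball (0 : EuclideanSpace ℝ (Fin 3)) 1)))
    {L : ℝ≥0} (hL : ∀ z, ‖newtonFarLaplacian ((1 / 2 : ℝ) / 2) (1 / 2) z‖ ≤ L)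
    {Q : Opens (ℝ × EuclideanSpace ℝ (Fin 3))}
    {f u : ℝ → EuclideanSpace ℝ (Fin 3) → EuclideanSpace ℝ (Fin 3)}
    {p : ℝ → EuclideanSpace ℝ (Fin 3) → ℝ}
    {G : ℝ → EuclideanSpace ℝ (Fin 3) → EuclideanSpace ℝ (Fin 3) →L[ℝ] EuclideanSpace ℝ (Fin 3)}
    (hsol : IsSuitableWeakSolutionOn Q 1 f u p)
    (hfi : LocallyIntegrableOn (uncurry f) (Q : Set (ℝ × EuclideanSpace ℝ (Fin 3))) volume)
    (hdivf : ∀ φ : ℝ → EuclideanSpace ℝ (Fin 3) → ℝ, IsSpaceTimeTestOn Q φ →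
      ∫ t, ∫ x, ⟪f t x, gradient (φ t) x⟫ = 0)
    (hG : HasWeakSpatialGradientOn Q u G)
    (hcl : closure (parabolicCylinder 1 (0 : ℝ × EuclideanSpace ℝ (Fin 3))) ⊆
      (Q : Set (ℝ × EuclideanSpace ℝ (Fin 3))))
    {θ : ℝ} (hθ : 0 < θ) (hθ2 : θ ≤ 1 / 2) :
    ∫⁻ z in parabolicCylinder θ (0 : ℝ × EuclideanSpace ℝ (Fin 3)), ‖p z.1 z.2‖ₑ ^ (3 / 2 : ℝ) ≤
      (9 * C₃ * (Kq : ℝ≥0∞) ^ (2 / 3 : ℝ) * 2 ^ (2 / 3 : ℝ) * (CP : ℝ≥0∞) ^ (1 / 3 : ℝ) *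
          cknAEss 1 0 u ^ (1 / 3 : ℝ) * cknE 1 0 G ^ (2 / 3 : ℝ) +
        L * volume (ball (0 : EuclideanSpace ℝ (Fin 3)) 1) * ENNReal.ofReal θ ^ 2 *
          cknD 1 0 p ^ (2 / 3 : ℝ)) ^ (3 / 2 : ℝ) := by
  -- finiteness
  have hA := hsol.cknAEss_one_ne_top hcl
  have hE := hsol.cknE_one_ne_top hG hcl
  have hD := hsol.cknD_one_ne_top hcl
  set cS : ℝ≥0∞ := 9 * C₃ * (Kq : ℝ≥0∞) ^ (2 / 3 : ℝ) * 2 ^ (2 / 3 : ℝ) * (CP : ℝ≥0∞) ^ (1 / 3 : ℝ) with hcS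
  have hcStop : cS ≠ ∞ := by
    rw [hcS]
    refine ENNReal.mul_ne_top (ENNReal.mul_ne_top (ENNReal.mul_ne_top (by simp [ENNReal.mul_ne_top])
      (ENNReal.rpow_ne_top_of_nonneg (by norm_num) ENNReal.coe_ne_top))
      (ENNReal.rpow_ne_top_of_nonneg (by norm_num) ENNReal.ofNat_ne_top))
      (ENNReal.rpow_ne_top_of_nonneg (by norm_num) ENNReal.coe_ne_top)
  set K : ℝ≥0∞ := cS * cknAEss 1 0 u ^ (1 / 3 : ℝ) * cknE 1 0 G ^ (2 / 3 : ℝ) +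
    L * volume (ball (0 : EuclideanSpace ℝ (Fin 3)) 1) * ENNReal.ofReal θ ^ 2 * cknD 1 0 p ^ (2 / 3 : ℝ)
    with hK
  have hKtop : K ≠ ∞ := by
    refine ENNReal.add_ne_top.2 ⟨?_, ?_⟩
    · exact ENNReal.mul_ne_top (ENNReal.mul_ne_top hcStop (ENNReal.rpow_ne_top_of_nonneg (by norm_num) hA))
        (ENNReal.rpow_ne_top_of_nonneg (by norm_num) hE)
    · exact ENNReal.mul_ne_top (ENNReal.mul_ne_top (ENNReal.mul_ne_top ENNReal.coe_ne_top
        measure_ball_lt_top.ne) (ENNReal.pow_ne_top ENNReal.ofReal_ne_top))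
        (ENNReal.rpow_ne_top_of_nonneg (by norm_num) hD)
  -- sets
  set S : Set (ℝ × EuclideanSpace ℝ (Fin 3)) := Ioo (-θ ^ 2) 0 ×ˢ ball (0 : EuclideanSpace ℝ (Fin 3)) θ
    with hS
  have hSeq : parabolicCylinder θ (0 : ℝ × EuclideanSpace ℝ (Fin 3)) = S := by
    simp [parabolicCylinder, hS]
  have hSo : IsOpen S := isOpen_Ioo.prod isOpen_ball
  set I : Set ℝ := Ioo (-1) 0 with hI
  set B : Set (EuclideanSpace ℝ (Fin 3)) := ball 0 1 with hB
  have hcyl : parabolicCylinder 1 (0 : ℝ × EuclideanSpace ℝ (Fin 3)) = I ×ˢ B := by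
    simp [parabolicCylinder, hI, hB]
  have hθ1 : θ ^ 2 ≤ 1 := by nlinarith
  have hSQ₁ : S ⊆ I ×ˢ B := prod_mono (Ioo_subset_Ioo (by linarith) le_rfl) (ball_subset_ball (by linarith))
  -- restriction to `Q₁`
  have hle : parabolicCylinderOpens 1 (0 : ℝ × EuclideanSpace ℝ (Fin 3)) ≤ Q := by
    intro z hz
    have hz' : z ∈ parabolicCylinder 1 (0 : ℝ × EuclideanSpace ℝ (Fin 3)) := by
      rwa [← coe_parabolicCylinderOpens]
    exact hcl (subset_closure hz')
  have h₁ : IsSuitableWeakSolutionOn (parabolicCylinderOpens 1 (0 : ℝ × EuclideanSpace ℝ (Fin 3))) 1 f u p :=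
    hsol.of_le hle
  have hG₁ := hG.mono hle
  have hfi₁ : LocallyIntegrableOn (uncurry f)
      ((parabolicCylinderOpens 1 (0 : ℝ × EuclideanSpace ℝ (Fin 3)) :
        Opens (ℝ × EuclideanSpace ℝ (Fin 3))) : Set (ℝ × EuclideanSpace ℝ (Fin 3))) volume :=
    hfi.mono_set hle
  have hdivf₁ : ∀ φ : ℝ → EuclideanSpace ℝ (Fin 3) → ℝ,
      IsSpaceTimeTestOn (parabolicCylinderOpens 1 (0 : ℝ × EuclideanSpace ℝ (Fin 3))) φ →
      ∫ t, ∫ x, ⟪f t x, gradient (φ t) x⟫ = 0 := fun φ hφ => hdivf φ (hφ.mono hle)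
  have hdivu : ∀ ϑ : ℝ → EuclideanSpace ℝ (Fin 3) → ℝ,
      IsSpaceTimeTestOn (parabolicCylinderOpens 1 (0 : ℝ × EuclideanSpace ℝ (Fin 3))) ϑ →
      ∫ z in parabolicCylinder 1 (0 : ℝ × EuclideanSpace ℝ (Fin 3)),
        ⟪u z.1 z.2, gradient (ϑ z.1) z.2⟫ = 0 := h₁.distributional.2.2.2.1
  have hu2 : LocallyIntegrableOn (fun z : ℝ × EuclideanSpace ℝ (Fin 3) => ‖u z.1 z.2‖ ^ 2)
      (parabolicCylinder 1 (0 : ℝ × EuclideanSpace ℝ (Fin 3))) volume := h₁.distributional.2.1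
  have hpm : AEStronglyMeasurable (uncurry p)
      (volume.restrict (parabolicCylinder 1 (0 : ℝ × EuclideanSpace ℝ (Fin 3)))) :=
    h₁.distributional.2.2.1.aestronglyMeasurable
  have hsub : Ioo (-θ ^ 2) 0 ×ˢ ball (0 : EuclideanSpace ℝ (Fin 3)) (θ + 1 / 2) ⊆
      ((parabolicCylinderOpens 1 (0 : ℝ × EuclideanSpace ℝ (Fin 3)) :
        Opens (ℝ × EuclideanSpace ℝ (Fin 3))) : Set (ℝ × EuclideanSpace ℝ (Fin 3))) := by
    rw [coe_parabolicCylinderOpens, hcyl]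
    exact prod_mono (Ioo_subset_Ioo (by linarith) le_rfl) (ball_subset_ball (by linarith))
  -- integrability of `p` on `S`
  have hpS : IntegrableOn (uncurry p) S volume := by
    have hK : closure S ⊆ (Q : Set (ℝ × EuclideanSpace ℝ (Fin 3))) :=
      (closure_mono (hSQ₁.trans (hcyl ▸ Subset.rfl))).trans hcl
    have hKc : IsCompact (closure S) :=
      (isCompact_closure_parabolicCylinder_one.of_isClosed_subset isClosed_closure
        (closure_mono (hSQ₁.trans (hcyl ▸ Subset.rfl))))
    exact (hsol.distributional.2.2.1.integrableOn_compact_subset hK hKc).mono_set subset_closure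
  -- ### the converse of Hölder's inequality
  have hpq : Real.HolderConjugate (3 / 2) 3 := Real.holderConjugate_iff.2 ⟨by norm_num, by norm_num⟩
  haveI : (volume : Measure (ℝ × EuclideanSpace ℝ (Fin 3))).IsAddHaarMeasure := by
    rw [Measure.volume_eq_prod]; infer_instance
  have key := FunctionSpaces.lintegral_rpow_enorm_le_of_forall_test (μ := volume) hSo hpS hpq
    (M := K.toReal) ENNReal.toReal_nonneg ?_
  · rw [hSeq]
    refine key.trans (le_of_eq ?_)
    rw [← ENNReal.ofReal_rpow_of_nonneg ENNReal.toReal_nonneg (by norm_num), ENNReal.ofReal_toReal hKtop]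
  -- ### the bound for one test function
  intro Ψ hΨ hΨc hΨS
  set θ' : ℝ → EuclideanSpace ℝ (Fin 3) → ℝ := fun t x => Ψ (t, x) with hθ'def
  have hθ' : IsSpaceTimeTestOn (⟨Ioo (-θ ^ 2) 0 ×ˢ ball (0 : EuclideanSpace ℝ (Fin 3)) θ,
      isOpen_Ioo.prod isOpen_ball⟩ : Opens (ℝ × EuclideanSpace ℝ (Fin 3))) θ' := ⟨hΨ, hΨc, hΨS⟩
  have hΨ0 : ∀ z, z ∉ S → Ψ z = 0 := fun z hz => image_eq_zero_of_notMem_tsupport fun h => hz (hΨS h)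
  -- the tested pressure equation
  have hid := h₁.distributional.integral_pressure_mul_test_eq hfi₁ hdivf₁ (ρ := 1 / 2) (by norm_num)
    hsub hθ'
  rw [coe_parabolicCylinderOpens] at hid
  -- `∫_S p Ψ = ∫∫_{Q₁} p θ'`
  have hLHS : ∫ z in S, uncurry p z * Ψ z =
      ∫ z in parabolicCylinder 1 (0 : ℝ × EuclideanSpace ℝ (Fin 3)), p z.1 z.2 * θ' z.1 z.2 := by
    rw [setIntegral_eq_integral_of_forall_compl_eq_zero (fun z hz => by rw [hΨ0 z hz, mul_zero]),
      setIntegral_eq_integral_of_forall_compl_eq_zero (fun z hz => ?_)]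
    · rfl
    · change p z.1 z.2 * Ψ (z.1, z.2) = 0
      rw [Prod.mk.eta, hΨ0 z (fun h => hz (hcyl ▸ hSQ₁ h)), mul_zero]
  -- the two bounds
  have hfar := enorm_integral_pressure_mul_newtonFarSmoothing_le_unitScale hpm hL hθ hθ1 hθ'
  have hcz := enorm_integral_hessian_le_doubleMeanZero_unitScale hC₃ hKq hCP hG₁ hu2 hdivu hA hE
    (ρ := 1 / 2) (by norm_num) (by linarith) hθ1 hθ'
  set T : ℝ≥0∞ := ∫⁻ z in Ioo (-θ ^ 2) 0 ×ˢ ball (0 : EuclideanSpace ℝ (Fin 3)) θ, ‖θ' z.1 z.2‖ₑ ^ (3 : ℝ)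
    with hT
  have hsupp : support (fun z : ℝ × EuclideanSpace ℝ (Fin 3) => ‖Ψ z‖ₑ ^ (3 : ℝ)) ⊆ S := by
    intro z hz
    by_contra hzS
    exact hz (by simp [hΨ0 z hzS, ENNReal.zero_rpow_of_pos (by norm_num : (0 : ℝ) < 3)])
  have hTeq : T = ∫⁻ z, ‖Ψ z‖ₑ ^ (3 : ℝ) := by
    rw [hT]
    exact setLIntegral_eq_of_support_subset hsupp
  have hTΨ : T ^ (1 / 3 : ℝ) = eLpNorm Ψ (ENNReal.ofReal 3) volume := by
    rw [show ENNReal.ofReal 3 = 3 by simp, eLpNorm_eq_lintegral_rpow_enorm_toReal (by norm_num) (by norm_num),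
      ENNReal.toReal_ofNat, hTeq]
  have hTfin : T ^ (1 / 3 : ℝ) ≠ ∞ := by
    rw [hTΨ]
    exact (hΨ.continuous.memLp_of_hasCompactSupport hΨc).eLpNorm_ne_top
  have hbound : ‖∫ z in S, uncurry p z * Ψ z‖ₑ ≤ K * T ^ (1 / 3 : ℝ) := by
    rw [hLHS, hid]
    refine enorm_sub_le.trans ?_
    calc _ ≤ L * volume (ball (0 : EuclideanSpace ℝ (Fin 3)) 1) * ENNReal.ofReal θ ^ 2 *
          cknD 1 0 p ^ (2 / 3 : ℝ) * T ^ (1 / 3 : ℝ) +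
        cS * cknAEss 1 0 u ^ (1 / 3 : ℝ) * cknE 1 0 G ^ (2 / 3 : ℝ) * T ^ (1 / 3 : ℝ) :=
          add_le_add hfar (by rw [hcS]; exact hcz)
      _ = K * T ^ (1 / 3 : ℝ) := by rw [hK]; ring
  calc |∫ z in S, uncurry p z * Ψ z| = ‖∫ z in S, uncurry p z * Ψ z‖ := (Real.norm_eq_abs _).symm
    _ = (‖∫ z in S, uncurry p z * Ψ z‖ₑ).toReal := (toReal_enorm _).symm
    _ ≤ (K * T ^ (1 / 3 : ℝ)).toReal := ENNReal.toReal_mono (ENNReal.mul_ne_top hKtop hTfin) hbound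
    _ = K.toReal * (eLpNorm Ψ (ENNReal.ofReal 3) volume).toReal := by rw [ENNReal.toReal_mul, hTΨ]

/-! ### Lemma 6.4 at unit scale with absolute constants -/

/-- **Seregin 2014, Lemma 6.4 (in the plain pressure quantity `D`), at unit scale**: there are
absolute `κ₇, κ₈` with `D(θ) ≤ κ₇ θ⁻² A(1)^{1/2} E(1) + κ₈ θ D(1)` for every suitable weak solution
(`ν = 1`) with locally integrable divergence-free force, every weak spatial gradient,
`closure Q₁ ⊆ Q` and `θ ∈ (0, 1/2]` — the analogue of the tree's `pressureEstimate_unitScale`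
(Robinson–Rodrigo–Sadowski 2016, Lemma 16.7: `κ₅ θ^{-3/2} A^{3/4} E^{3/4}`) with the velocity
entering as `A^{1/2} E`, as in (6.1.38)/(6.1.42) (there for the mean-free `D₀`, with `θ^{5/2}`).
[cite: Seregin2014, Lemma 6.4 (6.1.38)] -/
theorem pressureEstimateMeanZero_unitScale :
    ∃ κ₇ κ₈ : ℝ≥0, ∀ (Q : Opens (ℝ × EuclideanSpace ℝ (Fin 3)))
      (f u : ℝ → EuclideanSpace ℝ (Fin 3) → EuclideanSpace ℝ (Fin 3))
      (p : ℝ → EuclideanSpace ℝ (Fin 3) → ℝ)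
      (G : ℝ → EuclideanSpace ℝ (Fin 3) → EuclideanSpace ℝ (Fin 3) →L[ℝ] EuclideanSpace ℝ (Fin 3)),
      IsSuitableWeakSolutionOn Q 1 f u p →
      LocallyIntegrableOn (uncurry f) (Q : Set (ℝ × EuclideanSpace ℝ (Fin 3))) volume →
      (∀ φ : ℝ → EuclideanSpace ℝ (Fin 3) → ℝ, IsSpaceTimeTestOn Q φ →
        ∫ t, ∫ x, ⟪f t x, gradient (φ t) x⟫ = 0) →
      HasWeakSpatialGradientOn Q u G →
      closure (parabolicCylinder 1 (0 : ℝ × EuclideanSpace ℝ (Fin 3))) ⊆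
        (Q : Set (ℝ × EuclideanSpace ℝ (Fin 3))) →
      ∀ θ : ℝ, 0 < θ → θ ≤ 1 / 2 →
        cknD θ 0 p ≤
          κ₇ * ENNReal.ofReal ((θ ^ 2)⁻¹) * cknAEss 1 0 u ^ (1 / 2 : ℝ) * cknE 1 0 G +
            κ₈ * ENNReal.ofReal θ * cknD 1 0 p := by
  -- the constants
  have h13 : (1 : ℝ≥0∞) < 3 := by norm_num
  have h3top : (3 : ℝ≥0∞) < ⊤ := ENNReal.ofNat_lt_top
  obtain ⟨C₃, hC₃⟩ := stein1970_hessian_Lp_bound_holds_fin3.hessian_newtonNearPotential_half h13 h3top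
  obtain ⟨Kq, hKq⟩ := exists_lintegral_quadratic_sub_average_le_ball
  have hB₁c : IsConnected
      (((⟨ball (0 : EuclideanSpace ℝ (Fin 3)) 1, isOpen_ball⟩ : Opens (EuclideanSpace ℝ (Fin 3))) :
        Set (EuclideanSpace ℝ (Fin 3)))) :=
    ⟨⟨0, mem_ball_self one_pos⟩, (convex_ball (0 : EuclideanSpace ℝ (Fin 3)) 1).isPreconnected⟩
  obtain ⟨CP, hCP⟩ := FunctionSpaces.poincare_wirtinger_holds (E' := EuclideanSpace ℝ (Fin 3))
    (F := EuclideanSpace ℝ (Fin 3)) (FunctionSpaces.isLipschitzDomain_ball (0 : EuclideanSpace ℝ (Fin 3)) 1)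
    isBounded_ball hB₁c (2 : ℝ≥0∞) (by norm_num) volume
  have h₀ : (0 : ℝ) < (1 / 2 : ℝ) / 2 := by norm_num
  have h₁ : (1 / 2 : ℝ) / 2 < 1 / 2 := by norm_num
  obtain ⟨L₀, hL₀⟩ := (continuous_newtonFarLaplacian h₀ h₁).bounded_above_of_compact_support
    (hasCompactSupport_newtonFarLaplacian h₀.le h₁)
  set L : ℝ≥0 := L₀.toNNReal with hLdef
  have hL : ∀ z, ‖newtonFarLaplacian ((1 / 2 : ℝ) / 2) (1 / 2) z‖ ≤ L := fun z =>
    (hL₀ z).trans (Real.le_coe_toNNReal L₀)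
  set V : ℝ≥0∞ := volume (ball (0 : EuclideanSpace ℝ (Fin 3)) 1) with hV
  have hVtop : V ≠ ∞ := measure_ball_lt_top.ne
  set cS : ℝ≥0∞ := 9 * C₃ * (Kq : ℝ≥0∞) ^ (2 / 3 : ℝ) * 2 ^ (2 / 3 : ℝ) * (CP : ℝ≥0∞) ^ (1 / 3 : ℝ) with hcS
  have hcStop : cS ≠ ∞ := by
    rw [hcS]
    refine ENNReal.mul_ne_top (ENNReal.mul_ne_top (ENNReal.mul_ne_top (by simp [ENNReal.mul_ne_top])
      (ENNReal.rpow_ne_top_of_nonneg (by norm_num) ENNReal.coe_ne_top))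
      (ENNReal.rpow_ne_top_of_nonneg (by norm_num) ENNReal.ofNat_ne_top))
      (ENNReal.rpow_ne_top_of_nonneg (by norm_num) ENNReal.coe_ne_top)
  set k₇ : ℝ≥0∞ := (2 : ℝ≥0∞) ^ (1 / 2 : ℝ) * cS ^ (3 / 2 : ℝ) with hk₇
  set k₈ : ℝ≥0∞ := (2 : ℝ≥0∞) ^ (1 / 2 : ℝ) * ((L : ℝ≥0∞) * V) ^ (3 / 2 : ℝ) with hk₈
  have hk₇top : k₇ ≠ ∞ := ENNReal.mul_ne_top (ENNReal.rpow_ne_top_of_nonneg (by norm_num) ENNReal.ofNat_ne_top)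
    (ENNReal.rpow_ne_top_of_nonneg (by norm_num) hcStop)
  have hk₈top : k₈ ≠ ∞ := ENNReal.mul_ne_top (ENNReal.rpow_ne_top_of_nonneg (by norm_num) ENNReal.ofNat_ne_top)
    (ENNReal.rpow_ne_top_of_nonneg (by norm_num) (ENNReal.mul_ne_top ENNReal.coe_ne_top hVtop))
  refine ⟨k₇.toNNReal, k₈.toNNReal, fun Q f u p G hsol hfi hdivf hG hcl θ hθ hθ2 => ?_⟩
  rw [ENNReal.coe_toNNReal hk₇top, ENNReal.coe_toNNReal hk₈top]
  have key := setLIntegral_pressure_rpow_le_unitScale' hC₃ (fun f g hw ha he i j => hKq 0 1 one_pos f g hw ha he i j)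
    hCP hL hsol hfi hdivf hG hcl hθ hθ2
  set A := cknAEss 1 0 u with hAdef
  set EE := cknE 1 0 G with hEdef
  set D := cknD 1 0 p with hDdef
  set t := ENNReal.ofReal θ with ht
  have ht0 : t ≠ 0 := (ENNReal.ofReal_pos.2 hθ).ne'
  have httop : t ≠ ∞ := ENNReal.ofReal_ne_top
  set X : ℝ≥0∞ := cS * A ^ (1 / 3 : ℝ) * EE ^ (2 / 3 : ℝ) with hX
  set Y : ℝ≥0∞ := ((L : ℝ≥0∞) * V) * t ^ 2 * D ^ (2 / 3 : ℝ) with hY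
  have hkey' : ∫⁻ z in parabolicCylinder θ (0 : ℝ × EuclideanSpace ℝ (Fin 3)), ‖p z.1 z.2‖ₑ ^ (3 / 2 : ℝ) ≤
      (X + Y) ^ (3 / 2 : ℝ) := by
    refine key.trans (le_of_eq ?_)
    rw [hX, hY, hcS, hV]
  have hsplit : (X + Y) ^ (3 / 2 : ℝ) ≤ (2 : ℝ≥0∞) ^ (1 / 2 : ℝ) * (X ^ (3 / 2 : ℝ) + Y ^ (3 / 2 : ℝ)) := by
    have := ENNReal.rpow_add_le_mul_rpow_add_rpow X Y (p := 3 / 2) (by norm_num)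
    rwa [show (3 / 2 - 1 : ℝ) = 1 / 2 by norm_num] at this
  have hXp : X ^ (3 / 2 : ℝ) = cS ^ (3 / 2 : ℝ) * A ^ (1 / 2 : ℝ) * EE := by
    rw [hX, ENNReal.mul_rpow_of_nonneg _ _ (by norm_num : (0 : ℝ) ≤ 3 / 2),
      ENNReal.mul_rpow_of_nonneg cS (A ^ (1 / 3 : ℝ)) (by norm_num : (0 : ℝ) ≤ 3 / 2), ← ENNReal.rpow_mul A,
      ← ENNReal.rpow_mul EE]
    norm_num
  have hYp : Y ^ (3 / 2 : ℝ) = ((L : ℝ≥0∞) * V) ^ (3 / 2 : ℝ) * t ^ 3 * D := rpow_threeHalves_mul_sq_rpow _ _ _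
  -- divide by `θ²`
  have hDθ : cknD θ 0 p = (t ^ 2)⁻¹ *
      ∫⁻ z in parabolicCylinder θ (0 : ℝ × EuclideanSpace ℝ (Fin 3)), ‖p z.1 z.2‖ₑ ^ (3 / 2 : ℝ) := rfl
  have hinv : (ENNReal.ofReal θ ^ 2)⁻¹ = ENNReal.ofReal ((θ ^ 2)⁻¹) := by
    rw [← ENNReal.ofReal_pow hθ.le, ENNReal.ofReal_inv_of_pos (by positivity)]
  calc cknD θ 0 p ≤ (t ^ 2)⁻¹ * ((2 : ℝ≥0∞) ^ (1 / 2 : ℝ) * (X ^ (3 / 2 : ℝ) + Y ^ (3 / 2 : ℝ))) := by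
        rw [hDθ]; exact mul_le_mul' le_rfl (hkey'.trans hsplit)
    _ = (2 : ℝ≥0∞) ^ (1 / 2 : ℝ) * cS ^ (3 / 2 : ℝ) * (t ^ 2)⁻¹ * A ^ (1 / 2 : ℝ) * EE +
        (2 : ℝ≥0∞) ^ (1 / 2 : ℝ) * ((L : ℝ≥0∞) * V) ^ (3 / 2 : ℝ) * ((t ^ 2)⁻¹ * t ^ 3) * D := by
        rw [hXp, hYp]; ring
    _ = k₇ * ENNReal.ofReal ((θ ^ 2)⁻¹) * A ^ (1 / 2 : ℝ) * EE + k₈ * ENNReal.ofReal θ * D := by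
        rw [ht, ofReal_sq_inv_mul_cube hθ, hinv]

/-! ### Every centre and scale -/

/-- **Seregin 2014, Lemma 6.4 in the plain pressure quantity, every centre and scale**: there are
absolute `κ₇, κ₈` such that for every suitable weak solution `(u, p)` (`ν = 1`) with locally
integrable divergence-free force, every weak spatial gradient `G` of `u` on `Q`, every cylinder
with `closure Q_r(z) ⊆ Q` and every `θ ∈ (0, 1/2]`,
`D(θr; z) ≤ κ₇ θ⁻² A(r; z)^{1/2} E(r; z) + κ₈ θ D(r; z)` (`A = cknAEss`, `E = cknE`, `D = cknD`).
From the unit scale by the Navier–Stokes scaling, as `pressureEstimate_of_unitScale`.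
[cite: Seregin2014, Lemma 6.4 (6.1.38)] -/
theorem pressureEstimateMeanZero :
    ∃ κ₇ κ₈ : ℝ≥0, ∀ (Q : Opens (ℝ × EuclideanSpace ℝ (Fin 3)))
      (f u : ℝ → EuclideanSpace ℝ (Fin 3) → EuclideanSpace ℝ (Fin 3))
      (p : ℝ → EuclideanSpace ℝ (Fin 3) → ℝ)
      (G : ℝ → EuclideanSpace ℝ (Fin 3) → EuclideanSpace ℝ (Fin 3) →L[ℝ] EuclideanSpace ℝ (Fin 3)),
      IsSuitableWeakSolutionOn Q 1 f u p →
      LocallyIntegrableOn (uncurry f) (Q : Set (ℝ × EuclideanSpace ℝ (Fin 3))) volume →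
      (∀ φ : ℝ → EuclideanSpace ℝ (Fin 3) → ℝ, IsSpaceTimeTestOn Q φ →
        ∫ t, ∫ x, ⟪f t x, gradient (φ t) x⟫ = 0) →
      HasWeakSpatialGradientOn Q u G →
      ∀ (z : ℝ × EuclideanSpace ℝ (Fin 3)) (r θ : ℝ), 0 < r → 0 < θ → θ ≤ 1 / 2 →
        closure (parabolicCylinder r z) ⊆ (Q : Set (ℝ × EuclideanSpace ℝ (Fin 3))) →
        cknD (θ * r) z p ≤
          κ₇ * ENNReal.ofReal ((θ ^ 2)⁻¹) * cknAEss r z u ^ (1 / 2 : ℝ) * cknE r z G +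
            κ₈ * ENNReal.ofReal θ * cknD r z p := by
  obtain ⟨κ₇, κ₈, H⟩ := pressureEstimateMeanZero_unitScale
  refine ⟨κ₇, κ₈, fun Q f u p G hsol hfi hdivf hG z r θ hr hθ hθ' hcl => ?_⟩
  -- the zoomed data
  set Q' := stPreimage (r ^ 2) r z.1 z.2 Q with hQ'
  set u' := r • stPull (r ^ 2) r z.1 z.2 u with hu'
  set p' := r ^ 2 • stPull (r ^ 2) r z.1 z.2 p with hp'
  set f' := r ^ 3 • stPull (r ^ 2) r z.1 z.2 f with hf'
  set G' := r ^ 2 • stPull (r ^ 2) r z.1 z.2 G with hG'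
  have hr2 : (0 : ℝ) < r ^ 2 := by positivity
  have hsol' : IsSuitableWeakSolutionOn Q' 1 f' u' p' := by
    have := hsol.stRescale (α := r) (β := r ^ 2) (γ := r) hr hr (by ring) z.1 z.2
    rwa [show r * 1 / r = 1 by field_simp, show r ^ 2 * r = r ^ 3 by ring] at this
  have hfi' : LocallyIntegrableOn (uncurry f') (Q' : Set (ℝ × EuclideanSpace ℝ (Fin 3))) volume := by
    have := (hfi.uncurry_stPull hr2 hr z.1 z.2).smul (r ^ 3)
    exact this
  have hdivf' := iterated_inner_gradient_eq_zero_stPull hdivf hr z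
  have hG'' : HasWeakSpatialGradientOn Q' u' G' := by
    have := hG.stRescale r hr2 hr z.1 z.2
    rwa [← sq] at this
  have hcl' := closure_parabolicCylinder_one_subset_stPreimage hr hcl
  have key := H Q' f' u' p' G' hsol' hfi' hdivf' hG'' hcl' θ hθ hθ'
  -- transport the quantities back
  have hz : stAffine (r ^ 2) r z.1 z.2 (0 : ℝ × EuclideanSpace ℝ (Fin 3)) = z :=
    Prod.ext (by simp [stAffine]) (by simp [stAffine])
  have hA : cknAEss 1 0 u' = cknAEss r z u := by
    rw [hu', cknAEss_nsZoom hr one_pos z.1 z.2 0 u, hz, mul_one]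
  have hE : cknE 1 0 G' = cknE r z G := by
    rw [hG', cknE_nsZoom hr one_pos z.1 z.2 0 G, hz, mul_one]
  have hD : ∀ ρ : ℝ, 0 < ρ → cknD ρ 0 p' = cknD (ρ * r) z p := fun ρ hρ => by
    rw [hp', cknD_nsZoom hr hρ z.1 z.2 0 p, hz, mul_comm]
  rw [hD θ hθ, hA, hE, hD 1 one_pos, one_mul] at key
  exact key

/-! ### Cylinders touching the top of the domain -/

/-- **Seregin 2014, Lemma 6.4 in the plain pressure quantity, for cylinders `Q_R(z) ⊆ Q`
(possibly touching the top of `Q`)**, unforced case: there are absolute `κ₇, κ₈` such that for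
every suitable weak solution `(u, p)` of the unforced Navier–Stokes equations (`ν = 1`) on an
open `Q`, every weak spatial gradient `G` of `u` on `Q`, every backward cylinder with
`Q_R(z) ⊆ Q` and every `θ ∈ (0, 1/2]`,
`D(θR; z) ≤ κ₇ θ⁻² A(R; z)^{1/2} E(R; z) + κ₈ θ D(R; z)`. From `pressureEstimateMeanZero` on
the inner cylinders of `CKNInnerCylinders.lean` (data at most `2, 2, 4` times those of
`Q_R(z)`) and the exhaustion of `Q_{θR}(z)` by windows (Tsai 1998, remark after Lemma 4.2).
[cite: Seregin2014, Lemma 6.4 (6.1.38); Tsai1998 remark after Lemma 4.2 (p. 46)] -/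
theorem pressureEstimateMeanZero_top :
    ∃ κ₇ κ₈ : ℝ≥0, ∀ (Q : Opens (ℝ × EuclideanSpace ℝ (Fin 3)))
      (u : ℝ → EuclideanSpace ℝ (Fin 3) → EuclideanSpace ℝ (Fin 3))
      (p : ℝ → EuclideanSpace ℝ (Fin 3) → ℝ)
      (G : ℝ → EuclideanSpace ℝ (Fin 3) → EuclideanSpace ℝ (Fin 3) →L[ℝ] EuclideanSpace ℝ (Fin 3)),
      IsSuitableWeakSolutionOn Q 1 0 u p → HasWeakSpatialGradientOn Q u G →
      ∀ (z : ℝ × EuclideanSpace ℝ (Fin 3)) (R θ : ℝ), 0 < R → 0 < θ → θ ≤ 1 / 2 →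
        parabolicCylinder R z ⊆ (Q : Set (ℝ × EuclideanSpace ℝ (Fin 3))) →
        cknD (θ * R) z p ≤
          κ₇ * ENNReal.ofReal ((θ ^ 2)⁻¹) * cknAEss R z u ^ (1 / 2 : ℝ) * cknE R z G +
            κ₈ * ENNReal.ofReal θ * cknD R z p := by
  obtain ⟨κ₇, κ₈, H⟩ := pressureEstimateMeanZero
  refine ⟨κ₇ * 8, κ₈ * 4, fun Q u p G hsw hG z R θ hR hθ hθ2 hQ => ?_⟩
  obtain ⟨σ, hσh, hσ0, hσ1, hσm, hσt⟩ := exists_innerScales_half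
  set A := cknAEss R z u with hA
  set EE := cknE R z G with hEE
  set D := cknD R z p with hD
  set Kb : ℝ≥0∞ := (κ₇ * 8 : ℝ≥0) * ENNReal.ofReal ((θ ^ 2)⁻¹) * A ^ (1 / 2 : ℝ) * EE +
    (κ₈ * 4 : ℝ≥0) * ENNReal.ofReal θ * D with hKb
  have hθsq : θ ^ 2 ≤ 1 / 2 := by nlinarith
  have hf0 : LocallyIntegrableOn (uncurry (0 : ℝ → EuclideanSpace ℝ (Fin 3) → EuclideanSpace ℝ (Fin 3)))
      (Q : Set (ℝ × EuclideanSpace ℝ (Fin 3))) volume := locallyIntegrableOn_const 0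
  have hdiv0 : ∀ φ : ℝ → EuclideanSpace ℝ (Fin 3) → ℝ, IsSpaceTimeTestOn Q φ →
      ∫ t, ∫ x, ⟪(0 : ℝ → EuclideanSpace ℝ (Fin 3) → EuclideanSpace ℝ (Fin 3)) t x, gradient (φ t) x⟫ = 0 := by
    intro φ _; simp
  -- ### the bound on the inner cylinders, uniformly in `n`
  have inner : ∀ n : ℕ, cknD (θ * (σ n * R)) (z.1 - (R ^ 2 - (σ n * R) ^ 2) / 2, z.2) p ≤ Kb := by
    intro n
    set r' := σ n * R with hr'
    set z' : ℝ × EuclideanSpace ℝ (Fin 3) := (z.1 - (R ^ 2 - r' ^ 2) / 2, z.2) with hz'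
    have hr'0 : 0 < r' := mul_pos (hσ0 n) hR
    have hr'R : r' < R := by
      have := hσ1 n
      have : σ n * R < 1 * R := mul_lt_mul_of_pos_right this hR
      simpa [hr'] using this
    have hcl : closure (parabolicCylinder r' z') ⊆ (Q : Set (ℝ × EuclideanSpace ℝ (Fin 3))) :=
      (closure_parabolicCylinder_inner_subset hr'0 hr'R z).trans hQ
    have hsub : parabolicCylinder r' z' ⊆ parabolicCylinder R z :=
      parabolicCylinder_inner_subset hr'0 hr'R z
    have key := H Q 0 u p G hsw hf0 hdiv0 hG z' r' θ hr'0 hθ hθ2 hcl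
    have hratio1 : ENNReal.ofReal (R / r') ≤ 2 := by
      have h1 : R / r' ≤ 2 := by
        rw [div_le_iff₀ hr'0, hr']
        have := hσh n
        nlinarith
      calc ENNReal.ofReal (R / r') ≤ ENNReal.ofReal 2 := ENNReal.ofReal_le_ofReal h1
        _ = 2 := ENNReal.ofReal_ofNat 2
    have hratio : ENNReal.ofReal (R / r') ^ 2 ≤ 4 := by
      calc ENNReal.ofReal (R / r') ^ 2 ≤ 2 ^ 2 := by gcongr
        _ = 4 := by norm_num
    have hD' : cknD r' z' p ≤ 4 * D :=
      (cknD_le_mul_of_subset hR hr'0 hsub p).trans (mul_le_mul_left hratio _)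
    have hE' : cknE r' z' G ≤ 2 * EE :=
      (cknE_le_mul_of_subset hR hr'0 hsub G).trans (mul_le_mul_left hratio1 _)
    have hA' : cknAEss r' z' u ≤ 4 * A := by
      have hI : Ioo (z'.1 - r' ^ 2) z'.1 ⊆ Ioo (z.1 - R ^ 2) z.1 := Ioo_inner_subset hr'0 hr'R z.1
      have hB : ball z'.2 r' ⊆ ball z.2 R := ball_subset_ball hr'R.le
      refine (cknAEss_le_mul_of_subset hR hr'0 hI hB u).trans ((mul_le_mul_left hratio1 _).trans ?_)
      exact mul_le_mul_left (by norm_num) _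
    have hA'2 : cknAEss r' z' u ^ (1 / 2 : ℝ) ≤ 4 * A ^ (1 / 2 : ℝ) :=
      (ENNReal.rpow_le_rpow hA' (by norm_num)).trans (rpow_four_mul_le A (by norm_num) (by norm_num))
    refine key.trans ?_
    calc (κ₇ : ℝ≥0∞) * ENNReal.ofReal ((θ ^ 2)⁻¹) * cknAEss r' z' u ^ (1 / 2 : ℝ) * cknE r' z' G +
          κ₈ * ENNReal.ofReal θ * cknD r' z' p
        ≤ κ₇ * ENNReal.ofReal ((θ ^ 2)⁻¹) * (4 * A ^ (1 / 2 : ℝ)) * (2 * EE) +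
          κ₈ * ENNReal.ofReal θ * (4 * D) := by gcongr
      _ = Kb := by rw [hKb]; push_cast; ring
  -- ### the pressure quantity at the top by exhaustion
  rw [cknD, ← iSup_window_lintegral hσ0 hσ1 hσm hσt hR hθ z volume
    (fun w => ‖p w.1 w.2‖ₑ ^ (3 / 2 : ℝ)), ENNReal.mul_iSup]
  refine iSup_le fun n => ?_
  have hle : σ n * R ≤ R := by
    have := hσ1 n
    have : σ n * R < 1 * R := mul_lt_mul_of_pos_right this hR
    exact le_of_lt (by simpa using this)
  have hV := window_subset_parabolicCylinder_inner hθsq hle (mul_pos (hσ0 n) hR).le z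
  exact (window_lintegral_le_cknD hθ hle hV p).trans ((inner n).trans (le_of_eq (by rw [hKb])))


end Seregin2020

end Literature.Analysis.FluidPDE
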